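import Mathlib.Geometry.Manifold.Immersion
import Mathlib.Geometry.Manifold.SmoothEmbedding
import Mathlib.Geometry.Manifold.ContMDiffMFDeriv
import Mathlib.Geometry.Manifold.Instances.Sphere
import Mathlib.Analysis.SpecialFunctions.Trigonometric.Deriv
import Mathlib.Analysis.SpecialFunctions.Sqrt
import Mathlib.Analysis.InnerProductSpace.Calculus
import Mathlib.Analysis.Calculus.ContDiff.Deriv
import Mathlib.Analysis.Calculus.Deriv.Inv
import Mathlib.Analysis.Calculus.Deriv.Prod
import Mathlib.LinearAlgebra.Matrix.Determinant.Basic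
import Mathlib.LinearAlgebra.Matrix.Notation
import Mathlib.LinearAlgebra.CrossProduct
import Mathlib.Topology.MetricSpace.HausdorffDimension
import Literature.Topology.FourManifolds.Knots
import Literature.Topology.FourManifolds.DehnSurgery
import Literature.Topology.FourManifolds.TorusCoordinates
import Literature.Topology.FourManifolds.SmoothEmbeddingCriteria
import Literature.Topology.FourManifolds.InverseFunctionTheorem
import HarnessLib

/-!
# Every knot in `S³` has an oriented tubular neighbourhood

Sibling proof file of `DehnSurgery.lean` (D-0014: named facts `def X : Prop` are discharged as
`theorem X_holds : X`). It discharges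

* `Literature.Knot.nonempty_tubularNbhd_holds : Knot.nonempty_tubularNbhd` — every smooth knot
  `K : 𝕊¹ → 𝕊³` (`Literature.Topology.FourManifolds.Knot`, a `C^∞` embedding in Mathlib's sense) has an oriented tubular
  neighbourhood `ν : 𝕊¹ × ℝ² → 𝕊³` (`Literature.Topology.FourManifolds.Knot.TubularNbhd`: a `C^∞` embedding with
  `ν (x, 0) = K x` and positively oriented frame `det_pos`).

## Source and proof

Hirsch, *Differential Topology* (1976), Ch. 4 §5: Thm. 5.1 (a submanifold `M ⊆ ℝⁿ` has a
tubular neighbourhood: `f (x, y) = x + y` on a field of planes transverse to `M` has `Tf`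
invertible along the zero section, so it is a local diffeomorphism near it by the inverse
function theorem; it is injective on a smaller neighbourhood of the zero section since it is
injective on the zero section itself, Ex. 7 of §2.1; and a partial tubular neighbourhood contains
a full one, by shrinking the fibres), Thm. 5.2 (submanifolds of `V ⊆ ℝⁿ`: compose with a
retraction onto `V`) and §4 Ex. 2 (the normal bundle of `S¹ ⊆ S³`... is trivial). For the circle
in `S³ ⊆ ℝ⁴ = ℍ` everything is explicit, and the proof is carried out in coordinates
`(θ, w) ∈ ℝ × ℝ²` first (`θ` the angle on the knot, `γ θ = K (cos θ, sin θ)`, `w` the fibre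
coordinate) and packaged on the manifold `𝕊¹ × ℝ²` last:

**Part I (normal framing).**
* `Literature.Topology.FourManifolds.mfderiv_injective_of_isImmersionAt`: the differential of a `C^n` immersion (`1 ≤ n`,
  Mathlib's chart definition `Manifold.IsImmersionAt`, boundaryless source) is injective
  (Lee, *Introduction to Smooth Manifolds* (2013), Prop. 4.1; a Mathlib TODO in
  `Geometry/Manifold/Immersion.lean`).
* `Literature.SphereEmbedding.curve K θ = K (cos θ, sin θ) ∈ ℝ⁴`, the knot as a smooth `2π`-periodic
  curve on the unit sphere, and `Literature.SphereEmbedding.tangent K = (curve K)'`, which never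
  vanishes (`tangent_ne_zero`: `K` and `𝕊³ ⊆ ℝ⁴` are immersions) and is orthogonal to the curve.
* The standard parallelisation `frameX₁ p, frameX₂ p, frameX₃ p` of `𝕊³ ⊆ ℍ` (left
  multiplication by `i, j, k`), the determinant `frameDet` of four vectors of `ℝ⁴` with the
  identity `frameDet p (Σ aᵢXᵢp) (Σ bᵢXᵢp) (Σ cᵢXᵢp) = det (a, b, c) ‖p‖⁴`
  (`frameDet_frameComb`) and the orthogonal decomposition `norm_sq_smul_eq_frameComb`.
* `Literature.Topology.FourManifolds.exists_forall_cross_ne_zero`: a `C¹` curve in `ℝ³ ∖ 0` misses some direction `e`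
  (`v θ × e ≠ 0` for all `θ`) — the cone over the curve is a `C¹` image of `ℝ²`, whose complement
  is dense by the easy case of Sard's theorem in Mathlib
  (`ContDiff.dense_compl_range_of_finrank_lt_finrank`).
* `Literature.SphereEmbedding.normal₁ K`, `normal₂ K`: a smooth `2π`-periodic normal framing of the knot
  in `S³` (coordinates `v × e`, `v × (v × e)` in the parallelisation, `v` the coordinates of the
  velocity), orthogonal to the position vector, with
  `frameDet (γ, γ', N₁, N₂) > 0` (`frameDet_curve_tangent_normal_pos`) — the triviality *and* the
  orientation of the normal bundle of the knot (Hirsch §4.4 Ex. 2; the sign convention is the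
  field `det_pos` of `Literature.Topology.FourManifolds.Knot.TubularNbhd`).

**Part II (the tube in coordinates).** Hirsch's `f (x, y) = x + y` (Thm. 5.1) composed, as in
his Thm. 5.2, with the retraction `r (x) = x / ‖x‖` of `ℝ⁴ ∖ 0` onto `𝕊³`:
* `Literature.SphereEmbedding.tube K (θ, w) = (γ θ + w₀ N₁ θ + w₁ N₂ θ) / ‖…‖ ∈ 𝕊³`, smooth,
  `2π`-periodic in `θ`, equal to `γ θ` for `w = 0`.
* `Literature.tubeFrameDet G q = det (G, ∂_θ G, ∂_{w₀} G, ∂_{w₁} G) (q)`, the determinant of the field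
  `det_pos` (`tubeFrameDet_eq_det_deriv`); it is continuous for `C¹` maps, and `≠ 0` forces
  `fderiv` to be injective (`fderiv_injective_of_tubeFrameDet_ne_zero`).
* On the zero section `tubeFrameDet (tube K) (θ, 0) = det (γ, γ', N₁, N₂) > 0`
  (`tubeFrameDet_tube_zero`), hence (tube lemma over the compact parameter circle) it is positive
  on `ℝ × B (0, ε)` for `ε = jacobiRadius K > 0` (`tubeFrameDet_tube_pos`).
* `Literature.squeeze δ`, the diffeomorphism `w ↦ δ w / √(1 + ‖w‖²)` of `ℝ²` onto the disc of radius `δ`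
  ("a partial tubular neighbourhood contains a full one"), with its differential `squeezeFDeriv`
  and positive Jacobian `squeezeMatrix_det_pos`; `Literature.SphereEmbedding.tubeδ K δ =
  tube K ∘ (id × squeeze δ)`, whose Jacobian frame determinant is positive everywhere for
  `0 < δ ≤ jacobiRadius K` (`tubeFrameDet_tubeδ_pos`, `det_deriv_tubeδ_pos`,
  `fderiv_tubeδ_injective`).

**Part III (manifold packaging).**
* `Literature.periodicLift G`: the map `𝕊¹ × ℝ² → 𝕊³` induced by a `G : ℝ × ℝ² → 𝕊³ ⊆ ℝ⁴` which is
  `2π`-periodic in the angle (via the angle functions `angA`, `angB` of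
  `Literature.Topology.FourManifolds.TorusCoordinates`); it is smooth (`contMDiff_periodicLift`),
  its differential is injective where `fderiv G` is (`mfderiv_periodicLift_injective`, chain rule
  with the section `circlePoint × id`), hence (dimension count and the inverse function theorem
  on manifolds, `Literature.Topology.FourManifolds.isLocalDiffeomorphAt_of_mfderiv`) it is a local diffeomorphism and an
  immersion there (`Literature.Topology.FourManifolds.isImmersionAtOfComplement_of_eventuallyEq_openPartialHomeomorph`).
* `Literature.SphereEmbedding.preTubularMap K = periodicLift (tube K)`: equal to `K` on the zero section
  and a local diffeomorphism along it, hence injective on `𝕊¹ × B (0, r)` for an injectivity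
  radius `r = injRadius K > 0` (`exists_injOn_preTubularMap`, the compactness argument of
  Hirsch's Ex. 7 §2.1).
* `Literature.SphereEmbedding.tubularMap K = periodicLift (tubeδ K δ)` with
  `δ = tubularRadius K = min (jacobiRadius K) (injRadius K)`: injective, a local diffeomorphism
  everywhere, an immersion, an open embedding, equal to `K` on the zero section and positively
  oriented (`det_pos_tubularMap`); bundled as
  `Literature.SphereEmbedding.tubularNbhd K : Knot.TubularNbhd K`, whence
  `Literature.Topology.FourManifolds.Knot.nonempty_tubularNbhd_holds`.

## Design notes

* We compute in the coordinates of `EuclideanSpace ℝ (Fin 4)` with the three explicit linear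
  vector fields `frameX₁, frameX₂, frameX₃` rather than through `Quaternion ℝ`; all identities
  are closed by `ring` after the cofactor expansion `frameDet_expand`.
* The knot is parametrised by Mathlib's `circlePoint` (`2π`-periodic), because `det_pos`
  differentiates `t ↦ ν (circlePoint t, w)`; the angle functions `angA`, `angB` of
  `TorusCoordinates.lean` (unit period) enter only through `circlePoint (2π · angA u) = u`.
* Relation to `KnotFraming.lean` / `KnotTube.lean` (a topological tube `S¹ × ℝ² ↪ S³` for the
  knot-group facts, developed concurrently): those files frame the unit-period curve
  `t ↦ K (circlePt t)` without orientation data and are not imported here; the present file is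
  self-contained over `Knots`, `DehnSurgery`, `TorusCoordinates`, `SmoothEmbeddingCriteria` and
  `InverseFunctionTheorem`. In particular `Literature.Topology.FourManifolds.mfderiv_injective_of_isImmersionAtOfComplement`
  below and `Literature.Topology.FourManifolds.Manifold.IsImmersionAtOfComplement.mfderiv_injective` there are two proofs of
  the same folklore fact (hypothesis `1 ≤ n`, resp. `n ≠ 0`).

## References

* M. W. Hirsch, *Differential Topology*, GTM 33, Springer (1976), Ch. 4 §5 (tubular
  neighbourhoods), Thm. 5.1, Thm. 5.2, §2.1 Ex. 7, §4.4 Ex. 2; §1.3 (immersions).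
  [cite: Hirsch1976, §4.5 Thm 5.2]
* J. M. Lee, *Introduction to Smooth Manifolds*, 2nd ed., GTM 218 (2013), Prop. 4.1, Thm. 4.5,
  Prop. 4.8, 5.2 (immersions; the inverse function theorem on manifolds and local
  diffeomorphisms, as used through `Literature.Topology.FourManifolds.InverseFunctionTheorem` and
  `SmoothEmbeddingCriteria`).
-/

open scoped Manifold ContDiff Topology RealInnerProductSpace Matrix
open Function Set Module

noncomputable section

namespace Literature.Topology.FourManifolds

/-- Local notation: `𝔼 n` is the model Euclidean space `EuclideanSpace ℝ (Fin n)`. -/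
local notation "𝔼 " n:arg => EuclideanSpace ℝ (Fin n)

/-- Local notation: `𝕊 n` is the unit sphere in `EuclideanSpace ℝ (Fin (n + 1))`. -/
local notation "𝕊 " n:arg => (Metric.sphere (0 : EuclideanSpace ℝ (Fin (n + 1))) 1)

/-- Local notation: the model with corners of `𝕊¹ × ℝ²`. -/
local notation "𝓘₁₂" => (ModelWithCorners.prod (𝓡 1) 𝓘(ℝ, EuclideanSpace ℝ (Fin 2)))

/-! ## Part I. A positively oriented normal framing of the knot -/


/-! ### Determinants of four vectors of `ℝ⁴` -/

/-- The determinant `det (r₀, r₁, r₂, r₃)` of four vectors of `ℝ⁴` (rows). [folklore] -/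
def frameDet (r₀ r₁ r₂ r₃ : 𝔼 4) : ℝ :=
  Matrix.det (Matrix.of ![⇑r₀, ⇑r₁, ⇑r₂, ⇑r₃])

/-- `frameDet` is the determinant appearing in `Knot.TubularNbhd.det_pos`. [folklore] -/
theorem frameDet_eq (r₀ r₁ r₂ r₃ : 𝔼 4) :
    frameDet r₀ r₁ r₂ r₃ = Matrix.det (Matrix.of ![⇑r₀, ⇑r₁, ⇑r₂, ⇑r₃]) := rfl

/-- Cofactor expansion of `frameDet`. [folklore] -/
theorem frameDet_expand (r₀ r₁ r₂ r₃ : 𝔼 4) : frameDet r₀ r₁ r₂ r₃ =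
    r₀ 0 * (r₁ 1 * (r₂ 2 * r₃ 3 - r₂ 3 * r₃ 2) - r₁ 2 * (r₂ 1 * r₃ 3 - r₂ 3 * r₃ 1)
      + r₁ 3 * (r₂ 1 * r₃ 2 - r₂ 2 * r₃ 1))
    - r₀ 1 * (r₁ 0 * (r₂ 2 * r₃ 3 - r₂ 3 * r₃ 2) - r₁ 2 * (r₂ 0 * r₃ 3 - r₂ 3 * r₃ 0)
      + r₁ 3 * (r₂ 0 * r₃ 2 - r₂ 2 * r₃ 0))
    + r₀ 2 * (r₁ 0 * (r₂ 1 * r₃ 3 - r₂ 3 * r₃ 1) - r₁ 1 * (r₂ 0 * r₃ 3 - r₂ 3 * r₃ 0)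
      + r₁ 3 * (r₂ 0 * r₃ 1 - r₂ 1 * r₃ 0))
    - r₀ 3 * (r₁ 0 * (r₂ 1 * r₃ 2 - r₂ 2 * r₃ 1) - r₁ 1 * (r₂ 0 * r₃ 2 - r₂ 2 * r₃ 0)
      + r₁ 2 * (r₂ 0 * r₃ 1 - r₂ 1 * r₃ 0)) := by
  unfold frameDet
  rw [Matrix.det_succ_row_zero]
  simp [Fin.sum_univ_succ, Matrix.det_fin_three, Matrix.submatrix_apply, Fin.succAbove]
  ring

/-- Row operations: subtracting multiples of the first row does not change `frameDet`.
[folklore] -/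
theorem frameDet_sub_smul (r₀ r₁ r₂ r₃ : 𝔼 4) (s t u : ℝ) :
    frameDet r₀ (r₁ - s • r₀) (r₂ - t • r₀) (r₃ - u • r₀) = frameDet r₀ r₁ r₂ r₃ := by
  rw [frameDet_expand, frameDet_expand]
  simp
  ring

/-- Adding multiples of the first row to the last two rows does not change `frameDet`.
[folklore] -/
theorem frameDet_add_smul (r₀ r₁ r₂ r₃ : 𝔼 4) (t u : ℝ) :
    frameDet r₀ r₁ (t • r₀ + r₂) (u • r₀ + r₃) = frameDet r₀ r₁ r₂ r₃ := by
  rw [frameDet_expand, frameDet_expand]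
  simp
  ring

/-- Bilinearity of `frameDet` in the last two rows. [folklore] -/
theorem frameDet_comb₂ (r₀ r₁ r₂ r₃ : 𝔼 4) (a b c d : ℝ) :
    frameDet r₀ r₁ (a • r₂ + b • r₃) (c • r₂ + d • r₃) = (a * d - b * c) * frameDet r₀ r₁ r₂ r₃ := by
  rw [frameDet_expand, frameDet_expand]
  simp
  ring

/-- Homogeneity of `frameDet` in all rows at once. [folklore] -/
theorem frameDet_smul (r₀ r₁ r₂ r₃ : 𝔼 4) (a b : ℝ) :
    frameDet (a • r₀) (b • r₁) (b • r₂) (b • r₃) = a * b ^ 3 * frameDet r₀ r₁ r₂ r₃ := by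
  rw [frameDet_expand, frameDet_expand]
  simp
  ring

/-- If `frameDet r₀ r₁ r₂ r₃ ≠ 0` then `r₁, r₂, r₃` are linearly independent. [folklore] -/
theorem eq_zero_of_frameDet_ne_zero {r₀ r₁ r₂ r₃ : 𝔼 4} (h : frameDet r₀ r₁ r₂ r₃ ≠ 0)
    {t u v : ℝ} (h0 : t • r₁ + u • r₂ + v • r₃ = 0) : t = 0 ∧ u = 0 ∧ v = 0 := by
  by_contra hne
  apply h
  unfold frameDet
  rw [← Matrix.exists_vecMul_eq_zero_iff]
  refine ⟨![0, t, u, v], ?_, ?_⟩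
  · intro h'
    apply hne
    refine ⟨?_, ?_, ?_⟩
    · simpa using congrFun h' 1
    · simpa using congrFun h' 2
    · simpa using congrFun h' 3
  · funext j
    have := congrArg (fun x : 𝔼 4 ↦ x j) h0
    simp at this
    simp [Matrix.vecMul, dotProduct, Fin.sum_univ_succ]
    linarith

/-- `frameDet` is continuous in its four rows. [folklore] -/
theorem continuous_frameDet {X : Type*} [TopologicalSpace X] {r₀ r₁ r₂ r₃ : X → 𝔼 4}
    (h₀ : Continuous r₀) (h₁ : Continuous r₁) (h₂ : Continuous r₂) (h₃ : Continuous r₃) :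
    Continuous fun x ↦ frameDet (r₀ x) (r₁ x) (r₂ x) (r₃ x) := by
  have hc : ∀ {r : X → 𝔼 4}, Continuous r → ∀ i : Fin 4, Continuous fun x ↦ r x i :=
    fun hr i ↦ (EuclideanSpace.proj i).continuous.comp hr
  simp only [frameDet_expand]
  fun_prop (disch := assumption)

/-! ### The standard parallelisation of `𝕊³` -/

/-- Left multiplication by the quaternion `i` on `ℝ⁴ = ℍ`: a unit vector field on `𝕊³`
orthogonal to the position vector. [folklore] -/
def frameX₁ (p : 𝔼 4) : 𝔼 4 := !₂[-p 1, p 0, -p 3, p 2]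

/-- Left multiplication by the quaternion `j` on `ℝ⁴ = ℍ`. [folklore] -/
def frameX₂ (p : 𝔼 4) : 𝔼 4 := !₂[-p 2, p 3, p 0, -p 1]

/-- Left multiplication by the quaternion `k` on `ℝ⁴ = ℍ`. [folklore] -/
def frameX₃ (p : 𝔼 4) : 𝔼 4 := !₂[-p 3, -p 2, p 1, p 0]

/-- Coordinate `0` of `frameX₁ p`. [folklore] -/
@[simp] theorem frameX₁_apply_zero (p : 𝔼 4) : frameX₁ p 0 = -p 1 := rfl
/-- Coordinate `1` of `frameX₁ p`. [folklore] -/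
@[simp] theorem frameX₁_apply_one (p : 𝔼 4) : frameX₁ p 1 = p 0 := rfl
/-- Coordinate `2` of `frameX₁ p`. [folklore] -/
@[simp] theorem frameX₁_apply_two (p : 𝔼 4) : frameX₁ p 2 = -p 3 := rfl
/-- Coordinate `3` of `frameX₁ p`. [folklore] -/
@[simp] theorem frameX₁_apply_three (p : 𝔼 4) : frameX₁ p 3 = p 2 := rfl
/-- Coordinate `0` of `frameX₂ p`. [folklore] -/
@[simp] theorem frameX₂_apply_zero (p : 𝔼 4) : frameX₂ p 0 = -p 2 := rfl
/-- Coordinate `1` of `frameX₂ p`. [folklore] -/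
@[simp] theorem frameX₂_apply_one (p : 𝔼 4) : frameX₂ p 1 = p 3 := rfl
/-- Coordinate `2` of `frameX₂ p`. [folklore] -/
@[simp] theorem frameX₂_apply_two (p : 𝔼 4) : frameX₂ p 2 = p 0 := rfl
/-- Coordinate `3` of `frameX₂ p`. [folklore] -/
@[simp] theorem frameX₂_apply_three (p : 𝔼 4) : frameX₂ p 3 = -p 1 := rfl
/-- Coordinate `0` of `frameX₃ p`. [folklore] -/
@[simp] theorem frameX₃_apply_zero (p : 𝔼 4) : frameX₃ p 0 = -p 3 := rfl
/-- Coordinate `1` of `frameX₃ p`. [folklore] -/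
@[simp] theorem frameX₃_apply_one (p : 𝔼 4) : frameX₃ p 1 = -p 2 := rfl
/-- Coordinate `2` of `frameX₃ p`. [folklore] -/
@[simp] theorem frameX₃_apply_two (p : 𝔼 4) : frameX₃ p 2 = p 1 := rfl
/-- Coordinate `3` of `frameX₃ p`. [folklore] -/
@[simp] theorem frameX₃_apply_three (p : 𝔼 4) : frameX₃ p 3 = p 0 := rfl

/-- The tangent vector to `𝕊³` at `p` with coordinates `a` in the frame
`(frameX₁ p, frameX₂ p, frameX₃ p)`. [folklore] -/
def frameComb (p : 𝔼 4) (a : Fin 3 → ℝ) : 𝔼 4 :=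
  a 0 • frameX₁ p + a 1 • frameX₂ p + a 2 • frameX₃ p

/-- Unfolding of `frameComb`. [folklore] -/
theorem frameComb_def (p : 𝔼 4) (a : Fin 3 → ℝ) :
    frameComb p a = a 0 • frameX₁ p + a 1 • frameX₂ p + a 2 • frameX₃ p := rfl

/-- Coordinates of `frameComb p a`. [folklore] -/
@[simp] theorem frameComb_apply (p : 𝔼 4) (a : Fin 3 → ℝ) (j : Fin 4) :
    frameComb p a j = a 0 * frameX₁ p j + a 1 * frameX₂ p j + a 2 * frameX₃ p j := by
  simp [frameComb]

/-- The real inner product on `ℝ⁴` in coordinates. [folklore] -/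
theorem real_inner_fin_four (x y : 𝔼 4) : ⟪x, y⟫ = x 0 * y 0 + x 1 * y 1 + x 2 * y 2 + x 3 * y 3 := by
  simp [PiLp.inner_apply, Fin.sum_univ_four, mul_comm]

/-- The squared norm on `ℝ⁴` in coordinates. [folklore] -/
theorem norm_sq_fin_four (x : 𝔼 4) : ‖x‖ ^ 2 = x 0 ^ 2 + x 1 ^ 2 + x 2 ^ 2 + x 3 ^ 2 := by
  rw [← real_inner_self_eq_norm_sq, real_inner_fin_four]; ring

/-- **The frame determinant**: `det (p, Σ aᵢ Xᵢ p, Σ bᵢ Xᵢ p, Σ cᵢ Xᵢ p) = det (a, b, c) ‖p‖⁴`.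
[folklore] -/
theorem frameDet_frameComb (p : 𝔼 4) (a b c : Fin 3 → ℝ) :
    frameDet p (frameComb p a) (frameComb p b) (frameComb p c) =
      Matrix.det ![a, b, c] * (‖p‖ ^ 2) ^ 2 := by
  rw [frameDet_expand, Matrix.det_fin_three, norm_sq_fin_four]
  simp
  ring

/-- The frame vectors are orthogonal to the position vector. [folklore] -/
theorem inner_frameComb_left (p : 𝔼 4) (a : Fin 3 → ℝ) : ⟪frameComb p a, p⟫ = 0 := by
  rw [real_inner_fin_four]
  simp
  ring

/-- The coordinates `(⟪t, X₁ p⟫, ⟪t, X₂ p⟫, ⟪t, X₃ p⟫)` of a vector `t` in the frame at `p`.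
[folklore] -/
def frameCoords (p t : 𝔼 4) : Fin 3 → ℝ := ![⟪t, frameX₁ p⟫, ⟪t, frameX₂ p⟫, ⟪t, frameX₃ p⟫]

/-- Component `0` of `frameCoords`. [folklore] -/
@[simp] theorem frameCoords_zero (p t : 𝔼 4) : frameCoords p t 0 = ⟪t, frameX₁ p⟫ := rfl
/-- Component `1` of `frameCoords`. [folklore] -/
@[simp] theorem frameCoords_one (p t : 𝔼 4) : frameCoords p t 1 = ⟪t, frameX₂ p⟫ := rfl
/-- Component `2` of `frameCoords`. [folklore] -/
@[simp] theorem frameCoords_two (p t : 𝔼 4) : frameCoords p t 2 = ⟪t, frameX₃ p⟫ := rfl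

/-- **Orthogonal decomposition in the frame**: `‖p‖² t = ⟪t, p⟫ p + Σᵢ ⟪t, Xᵢ p⟫ Xᵢ p`, i.e.
`(p, X₁ p, X₂ p, X₃ p)` is an orthogonal frame of vectors of norm `‖p‖`. [folklore] -/
theorem norm_sq_smul_eq_frameComb (p t : 𝔼 4) :
    (‖p‖ ^ 2) • t = ⟪t, p⟫ • p + frameComb p (frameCoords p t) := by
  ext j
  rw [norm_sq_fin_four]
  simp only [frameCoords, real_inner_fin_four, PiLp.smul_apply, PiLp.add_apply, frameComb_apply,
    smul_eq_mul, Matrix.cons_val_zero, Matrix.cons_val_one, Matrix.cons_val]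
  fin_cases j <;> simp <;> ring

/-- A tangent vector `t ⊥ p` at a point `p` of the unit sphere is the frame combination of its
frame coordinates. [folklore] -/
theorem eq_frameComb_frameCoords {p t : 𝔼 4} (hp : ‖p‖ = 1) (ht : ⟪t, p⟫ = 0) :
    t = frameComb p (frameCoords p t) := by
  have := norm_sq_smul_eq_frameComb p t
  rwa [hp, one_pow, one_smul, ht, zero_smul, zero_add] at this

/-- `frameComb p a` depends continuously-differentiably on `(p, a)`: smoothness along curves.
[folklore] -/
theorem contDiff_frameComb {n : WithTop ℕ∞} {p : ℝ → 𝔼 4} {a : ℝ → Fin 3 → ℝ}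
    (hp : ContDiff ℝ n p) (ha : ContDiff ℝ n a) :
    ContDiff ℝ n fun θ ↦ frameComb (p θ) (a θ) := by
  have hpc : ∀ i : Fin 4, ContDiff ℝ n fun θ ↦ p θ i := fun i ↦ contDiff_euclidean.1 hp i
  have hac : ∀ i : Fin 3, ContDiff ℝ n fun θ ↦ a θ i := fun i ↦ contDiff_pi.1 ha i
  rw [contDiff_euclidean]
  intro j
  simp only [frameComb_apply]
  fin_cases j <;> simp <;> fun_prop (disch := assumption)

/-- The frame coordinates of `t θ` at `p θ` depend smoothly on `θ`. [folklore] -/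
theorem contDiff_frameCoords {n : WithTop ℕ∞} {p t : ℝ → 𝔼 4}
    (hp : ContDiff ℝ n p) (ht : ContDiff ℝ n t) :
    ContDiff ℝ n fun θ ↦ frameCoords (p θ) (t θ) := by
  have hpc : ∀ i : Fin 4, ContDiff ℝ n fun θ ↦ p θ i := fun i ↦ contDiff_euclidean.1 hp i
  have htc : ∀ i : Fin 4, ContDiff ℝ n fun θ ↦ t θ i := fun i ↦ contDiff_euclidean.1 ht i
  rw [contDiff_pi]
  intro j
  fin_cases j <;> simp [real_inner_fin_four] <;> fun_prop (disch := assumption)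

/-! ### Cross products: a vector nowhere parallel to a smooth curve in `ℝ³ ∖ 0` -/

/-- The determinant `det (v, v × e, v × (v × e)) = ‖v‖² ‖v × e‖²` (as sums of squares).
[folklore] -/
theorem det_cross_cross (v e : Fin 3 → ℝ) :
    Matrix.det ![v, v ⨯₃ e, v ⨯₃ (v ⨯₃ e)] =
      (v 0 ^ 2 + v 1 ^ 2 + v 2 ^ 2) *
        ((v ⨯₃ e) 0 ^ 2 + (v ⨯₃ e) 1 ^ 2 + (v ⨯₃ e) 2 ^ 2) := by
  rw [Matrix.det_fin_three]
  simp [cross_apply]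
  ring

/-- A nonzero vector of `ℝ³` has positive sum of squares. [folklore] -/
theorem sum_sq_pos_of_ne_zero {v : Fin 3 → ℝ} (hv : v ≠ 0) : 0 < v 0 ^ 2 + v 1 ^ 2 + v 2 ^ 2 := by
  by_contra hle
  apply hv
  have h0 : v 0 = 0 := by nlinarith [sq_nonneg (v 0), sq_nonneg (v 1), sq_nonneg (v 2)]
  have h1 : v 1 = 0 := by nlinarith [sq_nonneg (v 0), sq_nonneg (v 1), sq_nonneg (v 2)]
  have h2 : v 2 = 0 := by nlinarith [sq_nonneg (v 0), sq_nonneg (v 1), sq_nonneg (v 2)]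
  funext i
  fin_cases i <;> assumption

/-- `det (v, v × e, v × (v × e)) > 0` as soon as `v × e ≠ 0`. [folklore] -/
theorem det_cross_cross_pos {v e : Fin 3 → ℝ} (h : v ⨯₃ e ≠ 0) :
    0 < Matrix.det ![v, v ⨯₃ e, v ⨯₃ (v ⨯₃ e)] := by
  have hv : v ≠ 0 := by
    rintro rfl
    exact h (by simp)
  rw [det_cross_cross]
  exact mul_pos (sum_sq_pos_of_ne_zero hv) (sum_sq_pos_of_ne_zero h)

/-- If `e` is not a multiple of the nonzero vector `v`, then `v × e ≠ 0`. [folklore] -/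
theorem cross_ne_zero_of_forall_smul_ne {v e : Fin 3 → ℝ} (hv : v ≠ 0) (he : ∀ r : ℝ, r • v ≠ e) :
    v ⨯₃ e ≠ 0 := by
  rw [crossProduct_ne_zero_iff_linearIndependent, LinearIndependent.pair_iff]
  intro s t hst
  by_cases ht : t = 0
  · subst ht
    rw [zero_smul, add_zero] at hst
    exact ⟨(smul_eq_zero.1 hst).resolve_right hv, rfl⟩
  · exfalso
    apply he (-(s / t))
    have : t • e = -(s • v) := eq_neg_of_add_eq_zero_right hst
    calc -(s / t) • v = t⁻¹ • (-(s • v)) := by rw [smul_neg, smul_smul, neg_smul]; ring_nf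
      _ = e := by rw [← this, smul_smul, inv_mul_cancel₀ ht, one_smul]

/-- **A smooth curve in `ℝ³ ∖ 0` misses some direction**: the cone `{r v(θ)}` is the image of
`ℝ²` under a `C¹` map, so (Sard: `ContDiff.dense_compl_range_of_finrank_lt_finrank`) its
complement is dense, in particular nonempty; any `e` outside it is nowhere parallel to `v`,
i.e. `v θ × e ≠ 0` for all `θ`. [folklore] -/
theorem exists_forall_cross_ne_zero {v : ℝ → Fin 3 → ℝ} (hv : ContDiff ℝ 1 v)
    (h0 : ∀ θ, v θ ≠ 0) : ∃ e : Fin 3 → ℝ, ∀ θ, v θ ⨯₃ e ≠ 0 := by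
  set f : ℝ × ℝ → (Fin 3 → ℝ) := fun q ↦ q.1 • v q.2 with hf
  have hfd : ContDiff ℝ 1 f := contDiff_fst.smul (hv.comp contDiff_snd)
  have hdim : finrank ℝ (ℝ × ℝ) < finrank ℝ (Fin 3 → ℝ) := by simp
  obtain ⟨e, he⟩ := (hfd.dense_compl_range_of_finrank_lt_finrank hdim).nonempty
  refine ⟨e, fun θ ↦ cross_ne_zero_of_forall_smul_ne (h0 θ) fun r hr ↦ he ⟨(r, θ), hr⟩⟩


/-! ### Immersions have injective differential -/

section Immersion

variable {E H E' H' F : Type*} [NormedAddCommGroup E] [NormedSpace ℝ E] [TopologicalSpace H]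
  [NormedAddCommGroup E'] [NormedSpace ℝ E'] [TopologicalSpace H']
  [NormedAddCommGroup F] [NormedSpace ℝ F]
  {I : ModelWithCorners ℝ E H} {J : ModelWithCorners ℝ E' H'} [I.Boundaryless]
  {M : Type*} [TopologicalSpace M] [ChartedSpace H M]
  {N : Type*} [TopologicalSpace N] [ChartedSpace H' N]
  {n : WithTop ℕ∞} {f : M → N} {x : M}

/-- **The differential of an immersion is injective** (fixed complement). If `f` reads
`u ↦ L (u, 0)` in charts `φ`, `ψ` of the `C^n` maximal atlases (`1 ≤ n`, source model
boundaryless), then `dψ ∘ df ∘ d(φ⁻¹) = L ∘ inl` at `φ x` by the chain rule, and `d(φ⁻¹) ∘ dφ = id`,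
so `L ∘ inl ∘ dφ = dψ ∘ df` is injective, whence `df` is injective. Lee, *Introduction to Smooth
Manifolds* (2013), Prop. 4.1 (converse direction); Mathlib TODO in
`Geometry/Manifold/Immersion.lean`. [folklore] -/
theorem mfderiv_injective_of_isImmersionAtOfComplement
    (h : Manifold.IsImmersionAtOfComplement F I J n f x) (hn : 1 ≤ n) :
    Injective (mfderiv I J f x) := by
  have hn0 : n ≠ 0 := (zero_lt_one.trans_le hn).ne'
  set φ := h.domChart with hφdef
  set ψ := h.codChart with hψdef
  have hφ := h.domChart_mem_maximalAtlas
  have hψ := h.codChart_mem_maximalAtlas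
  have hxφ : x ∈ φ.source := h.mem_domChart_source
  have hfxψ : f x ∈ ψ.source := h.mem_codChart_source
  set e₀ : E := φ.extend I x with he₀
  have hxφ' : x ∈ (φ.extend I).source := by rwa [OpenPartialHomeomorph.extend_source]
  have hx' : (φ.extend I).symm e₀ = x := (φ.extend I).left_inv hxφ'
  have he₀t : e₀ ∈ (φ.extend I).target := (φ.extend I).map_source hxφ'
  -- smoothness of the four maps
  have h1 : ContMDiffAt I 𝓘(ℝ, E) n (φ.extend I) x := φ.contMDiffAt_extend hφ hxφ
  have h2 : ContMDiffAt 𝓘(ℝ, E) I n (φ.extend I).symm e₀ := by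
    have ho : IsOpen (I '' φ.target) := by
      rw [← OpenPartialHomeomorph.extend_target']
      exact OpenPartialHomeomorph.isOpen_extend_target (f := φ) (I := I)
    exact (contMDiffOn_extend_symm hφ).contMDiffAt (ho.mem_nhds ⟨φ x, φ.map_source hxφ, rfl⟩)
  have h3 : ContMDiffAt J 𝓘(ℝ, E') n (ψ.extend J) (f x) := ψ.contMDiffAt_extend hψ hfxψ
  have h4 : ContMDiffAt I J n f x := h.contMDiffAt
  -- their differentials
  set Dφ := mfderiv I 𝓘(ℝ, E) (φ.extend I) x with hDφ
  set S := mfderiv 𝓘(ℝ, E) I (φ.extend I).symm e₀ with hS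
  set T := mfderiv J 𝓘(ℝ, E') (ψ.extend J) (f x) with hT
  set Df := mfderiv I J f x with hDf
  have D1 : HasMFDerivAt I 𝓘(ℝ, E) (φ.extend I) x Dφ := (h1.mdifferentiableAt hn0).hasMFDerivAt
  have D2 : HasMFDerivAt 𝓘(ℝ, E) I (φ.extend I).symm e₀ S := (h2.mdifferentiableAt hn0).hasMFDerivAt
  have D3 : HasMFDerivAt J 𝓘(ℝ, E') (ψ.extend J) (f x) T := (h3.mdifferentiableAt hn0).hasMFDerivAt
  have D4 : HasMFDerivAt I J f x Df := (h4.mdifferentiableAt hn0).hasMFDerivAt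
  -- (a) `S ∘ Dφ = id`
  have key1 : S.comp Dφ = ContinuousLinearMap.id ℝ (TangentSpace I x) := by
    have hc : HasMFDerivAt I I ((φ.extend I).symm ∘ (φ.extend I)) x (S.comp Dφ) := by
      have D2' : HasMFDerivAt 𝓘(ℝ, E) I (φ.extend I).symm (φ.extend I x) S := D2
      exact D2'.comp x D1
    have heq : ((φ.extend I).symm ∘ (φ.extend I)) =ᶠ[𝓝 x] id := by
      filter_upwards [φ.open_source.mem_nhds hxφ] with y hy
      exact (φ.extend I).left_inv (by rwa [OpenPartialHomeomorph.extend_source])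
    exact hasMFDerivAt_unique (hc.congr_of_eventuallyEq heq.symm) (hasMFDerivAt_id x)
  -- (b) the composite `ψ ∘ f ∘ φ⁻¹` has differential `T ∘ Df ∘ S` and equals `L ∘ inl` near `e₀`
  set A : E →L[ℝ] E' := (h.equiv : (E × F) →L[ℝ] E').comp (ContinuousLinearMap.inl ℝ E F) with hA
  have key2 : T.comp (Df.comp S) = A := by
    have hc1 : HasMFDerivAt I 𝓘(ℝ, E') ((ψ.extend J) ∘ f) x (T.comp Df) := D3.comp x D4
    have hc1' : HasMFDerivAt I 𝓘(ℝ, E') ((ψ.extend J) ∘ f) ((φ.extend I).symm e₀) (T.comp Df) := by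
      rw [hx']; exact hc1
    have hc2 : HasMFDerivAt 𝓘(ℝ, E) 𝓘(ℝ, E') (((ψ.extend J) ∘ f) ∘ (φ.extend I).symm) e₀
        ((T.comp Df).comp S) := hc1'.comp e₀ D2
    have hA' : HasMFDerivAt 𝓘(ℝ, E) 𝓘(ℝ, E') (h.equiv ∘ fun u : E ↦ (u, (0 : F))) e₀ A := by
      rw [hasMFDerivAt_iff_hasFDerivAt]
      have : (h.equiv ∘ fun u : E ↦ (u, (0 : F))) = ⇑A := by
        funext u; simp [hA]
      rw [this]
      exact A.hasFDerivAt
    have heq : (((ψ.extend J) ∘ f) ∘ (φ.extend I).symm) =ᶠ[𝓝 e₀]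
        (h.equiv ∘ fun u : E ↦ (u, (0 : F))) := by
      filter_upwards [(OpenPartialHomeomorph.isOpen_extend_target (f := φ) (I := I)).mem_nhds he₀t]
        with u hu
      exact h.writtenInCharts hu
    have := hasMFDerivAt_unique hc2 (hA'.congr_of_eventuallyEq heq)
    rw [← this, ContinuousLinearMap.comp_assoc]
  -- (c) conclude: `A ∘ Dφ = T ∘ Df` with `A`, `Dφ` injective
  have hAinj : Injective A := by
    intro u v huv
    simp only [hA, ContinuousLinearMap.coe_comp, comp_apply, ContinuousLinearMap.inl_apply] at huv
    exact (Prod.ext_iff.1 (h.equiv.injective huv)).1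
  have hDφ : Injective Dφ := by
    refine LeftInverse.injective (g := S) fun v ↦ ?_
    exact DFunLike.congr_fun key1 v
  have hcomp : Injective ((T : _ → _) ∘ (Df : _ → _)) := by
    have hfun : ((T : _ → _) ∘ (Df : _ → _)) = (A : E → E') ∘ (Dφ : _ → _) := by
      funext v
      have h2 := DFunLike.congr_fun key2 (Dφ v)
      have h1 : S (Dφ v) = v := DFunLike.congr_fun key1 v
      show T (Df v) = A (Dφ v)
      exact (congrArg (fun w ↦ T (Df w)) h1).symm.trans h2
    rw [hfun]
    exact hAinj.comp hDφ
  exact Injective.of_comp hcomp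

/-- **The differential of an immersion is injective**: `Manifold.IsImmersionAt I J n f x` with
`1 ≤ n` and boundaryless source model implies that `mfderiv I J f x` is injective.
Lee (2013), Prop. 4.1; Mathlib TODO in `Geometry/Manifold/Immersion.lean`. [folklore] -/
theorem mfderiv_injective_of_isImmersionAt (h : Manifold.IsImmersionAt I J n f x) (hn : 1 ≤ n) :
    Injective (mfderiv I J f x) :=
  mfderiv_injective_of_isImmersionAtOfComplement h.isImmersionAtOfComplement_complement hn

/-- The differential of a `C^n` immersion (`1 ≤ n`, boundaryless source) is injective at every
point. [folklore] -/
theorem mfderiv_injective_of_isImmersion (h : Manifold.IsImmersion I J n f) (hn : 1 ≤ n) (x : M) :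
    Injective (mfderiv I J f x) :=
  mfderiv_injective_of_isImmersionAt (h.isImmersionAt x) hn

end Immersion

/-! ### The parametrised circle -/

/-- `finrank ℝ ℝ² = 1 + 1`, in the syntactic form needed by the sphere API for `𝕊 1`
(pattern of Mathlib's `finrank_real_complex_fact'`; used as a local instance). [folklore] -/
theorem fact_finrank_euclideanSpace_two :
    Fact (Module.finrank ℝ (EuclideanSpace ℝ (Fin (1 + 1))) = 1 + 1) :=
  ⟨finrank_euclideanSpace_fin⟩

/-- `finrank ℝ ℝ⁴ = 3 + 1`, in the syntactic form needed by the sphere API for `𝕊 3`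
(used as a local instance). [folklore] -/
theorem fact_finrank_euclideanSpace_four :
    Fact (Module.finrank ℝ (EuclideanSpace ℝ (Fin (3 + 1))) = 3 + 1) :=
  ⟨finrank_euclideanSpace_fin⟩

attribute [local instance] fact_finrank_euclideanSpace_two fact_finrank_euclideanSpace_four

/-- `circlePoint : ℝ → 𝕊¹` is smooth. [folklore] -/
theorem contMDiff_circlePoint : ContMDiff 𝓘(ℝ, ℝ) (𝓡 1) ∞ circlePoint :=
  contDiff_coe_circlePoint.contMDiff.codRestrict_sphere fun θ ↦ (circlePoint θ).2

/-- The velocity of `θ ↦ (cos θ, sin θ) ∈ ℝ²` never vanishes. [folklore] -/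
theorem deriv_coe_circlePoint_ne_zero (θ : ℝ) :
    deriv (fun t ↦ ((circlePoint t : 𝕊 1) : 𝔼 2)) θ ≠ 0 := by
  intro h0
  have hd : HasDerivAt (fun t ↦ ((circlePoint t : 𝕊 1) : 𝔼 2))
      (deriv (fun t ↦ ((circlePoint t : 𝕊 1) : 𝔼 2)) θ) θ :=
    ((contDiff_coe_circlePoint.differentiable (by simp)) θ).hasDerivAt
  rw [h0] at hd
  have h₀ := (EuclideanSpace.proj (0 : Fin 2) : 𝔼 2 →L[ℝ] ℝ).hasFDerivAt.comp_hasDerivAt θ hd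
  have h₁ := (EuclideanSpace.proj (1 : Fin 2) : 𝔼 2 →L[ℝ] ℝ).hasFDerivAt.comp_hasDerivAt θ hd
  have e₀ : ((EuclideanSpace.proj (0 : Fin 2) : 𝔼 2 →L[ℝ] ℝ) ∘ fun t ↦ ((circlePoint t : 𝕊 1) : 𝔼 2))
      = Real.cos := by
    funext t; exact circlePoint_apply_zero t
  have e₁ : ((EuclideanSpace.proj (1 : Fin 2) : 𝔼 2 →L[ℝ] ℝ) ∘ fun t ↦ ((circlePoint t : 𝕊 1) : 𝔼 2))
      = Real.sin := by
    funext t; exact circlePoint_apply_one t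
  rw [e₀, map_zero] at h₀
  rw [e₁, map_zero] at h₁
  have hs : -Real.sin θ = 0 := (Real.hasDerivAt_cos θ).unique h₀
  have hc : Real.cos θ = 0 := (Real.hasDerivAt_sin θ).unique h₁
  have := Real.sin_sq_add_cos_sq θ
  rw [neg_eq_zero] at hs
  rw [hs, hc] at this
  norm_num at this

/-- The differential of `circlePoint : ℝ → 𝕊¹` vanishes nowhere: composed with the (injective)
differential of the inclusion `𝕊¹ ⊆ ℝ²` it is the velocity `(-sin θ, cos θ) ≠ 0`. [folklore] -/
theorem mfderiv_circlePoint_apply_ne_zero (θ : ℝ) :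
    mfderiv 𝓘(ℝ, ℝ) (𝓡 1) circlePoint θ (1 : ℝ) ≠ 0 := by
  intro h0
  have hn : (∞ : WithTop ℕ∞) ≠ 0 := by simp
  have hcomp : mfderiv 𝓘(ℝ, ℝ) 𝓘(ℝ, 𝔼 2) ((Subtype.val : (𝕊 1) → 𝔼 2) ∘ circlePoint) θ =
      (mfderiv (𝓡 1) 𝓘(ℝ, 𝔼 2) (Subtype.val : (𝕊 1) → 𝔼 2) (circlePoint θ)).comp
        (mfderiv 𝓘(ℝ, ℝ) (𝓡 1) circlePoint θ) :=
    mfderiv_comp θ (contMDiff_coe_sphere.mdifferentiableAt hn)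
      (contMDiff_circlePoint.mdifferentiableAt hn)
  apply deriv_coe_circlePoint_ne_zero θ
  have hder : deriv (fun t ↦ ((circlePoint t : 𝕊 1) : 𝔼 2)) θ =
      mfderiv 𝓘(ℝ, ℝ) 𝓘(ℝ, 𝔼 2) ((Subtype.val : (𝕊 1) → 𝔼 2) ∘ circlePoint) θ (1 : ℝ) := by
    rw [mfderiv_eq_fderiv]; rfl
  rw [hder, hcomp]
  change (mfderiv (𝓡 1) 𝓘(ℝ, 𝔼 2) (Subtype.val : (𝕊 1) → 𝔼 2) (circlePoint θ))
    (mfderiv 𝓘(ℝ, ℝ) (𝓡 1) circlePoint θ (1 : ℝ)) = 0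
  rw [h0, map_zero]

/-- Two reals with the same point on the circle differ by an integer multiple of `2π`.
[folklore] -/
theorem exists_eq_add_of_circlePoint_eq {s t : ℝ} (h : circlePoint s = circlePoint t) :
    ∃ k : ℤ, s = t + k * (2 * Real.pi) := by
  have hc : Real.cos s = Real.cos t := by
    rw [← circlePoint_apply_zero, ← circlePoint_apply_zero, h]
  have hs : Real.sin s = Real.sin t := by
    rw [← circlePoint_apply_one, ← circlePoint_apply_one, h]
  obtain ⟨k, hk⟩ := Real.Angle.angle_eq_iff_two_pi_dvd_sub.1 (Real.Angle.cos_sin_inj hc hs)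
  exact ⟨k, by linarith⟩

/-- A function which is `2π`-periodic in a real argument takes equal values at reals with the
same point on the circle. [folklore] -/
theorem Periodic.eq_of_circlePoint_eq {α : Type*} {g : ℝ → α} (hg : Periodic g (2 * Real.pi))
    {s t : ℝ} (h : circlePoint s = circlePoint t) : g s = g t := by
  obtain ⟨k, rfl⟩ := exists_eq_add_of_circlePoint_eq h
  exact hg.int_mul k t

/-! ### The knot as a periodic curve in `ℝ⁴` -/

namespace SphereEmbedding

variable (K : Knot)

/-- The parametrised knot `γ (θ) = K (cos θ, sin θ)` as a curve in `ℝ⁴ ⊇ 𝕊³`. [folklore] -/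
def curve (θ : ℝ) : 𝔼 4 := ((K (circlePoint θ) : 𝕊 3) : 𝔼 4)

/-- Unfolding of `SphereEmbedding.curve`. [folklore] -/
theorem curve_apply (θ : ℝ) : K.curve θ = ((K (circlePoint θ) : 𝕊 3) : 𝔼 4) := rfl

/-- The curve of a knot is `2π`-periodic. [folklore] -/
theorem periodic_curve : Periodic K.curve (2 * Real.pi) := fun θ ↦ by
  rw [curve_apply, curve_apply, circlePoint_add_two_pi]

/-- The curve of a knot lies on the unit sphere. [folklore] -/
@[simp] theorem norm_curve (θ : ℝ) : ‖K.curve θ‖ = 1 := by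
  rw [curve_apply, norm_eq_of_mem_sphere]

/-- The knot followed by the inclusion `𝕊³ ⊆ ℝ⁴` is smooth. [folklore] -/
theorem contMDiff_coe_comp : ContMDiff (𝓡 1) 𝓘(ℝ, 𝔼 4) ∞ fun u : 𝕊 1 ↦ ((K u : 𝕊 3) : 𝔼 4) :=
  contMDiff_coe_sphere.comp K.contMDiff

/-- The curve of a knot is smooth. [folklore] -/
theorem contDiff_curve : ContDiff ℝ ∞ K.curve := by
  rw [← contMDiff_iff_contDiff]
  exact K.contMDiff_coe_comp.comp contMDiff_circlePoint

/-- The curve of a knot is differentiable. [folklore] -/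
theorem differentiable_curve : Differentiable ℝ K.curve :=
  K.contDiff_curve.differentiable (by simp)

/-- The curve of a knot is continuous. [folklore] -/
@[continuity, fun_prop]
theorem continuous_curve : Continuous K.curve := K.contDiff_curve.continuous

/-- The differential of `u ↦ K u ∈ ℝ⁴` is injective at every point of `𝕊¹`: `K` is an immersion
(`Literature.Topology.FourManifolds.mfderiv_injective_of_isImmersion`) and so is the inclusion of the sphere
(`mfderiv_coe_sphere_injective`). [folklore] -/
theorem mfderiv_coe_comp_injective (u : 𝕊 1) :
    Injective (mfderiv (𝓡 1) 𝓘(ℝ, 𝔼 4) (fun u : 𝕊 1 ↦ ((K u : 𝕊 3) : 𝔼 4)) u) := by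
  have hn : (∞ : WithTop ℕ∞) ≠ 0 := by simp
  rw [show (fun u : 𝕊 1 ↦ ((K u : 𝕊 3) : 𝔼 4)) = Subtype.val ∘ K from rfl,
    mfderiv_comp u (contMDiff_coe_sphere.mdifferentiableAt hn) (K.contMDiff.mdifferentiableAt hn)]
  exact (mfderiv_coe_sphere_injective (n := 3) (K u)).comp
    (mfderiv_injective_of_isImmersion K.isSmoothEmbedding.isImmersion (by simp) u)

/-- The velocity `γ' = dγ/dθ` of the curve of a knot. [folklore] -/
def tangent (θ : ℝ) : 𝔼 4 := deriv K.curve θ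

/-- Unfolding of `SphereEmbedding.tangent`. [folklore] -/
theorem tangent_apply (θ : ℝ) : K.tangent θ = deriv K.curve θ := rfl

/-- The curve of a knot has derivative its velocity. [folklore] -/
theorem hasDerivAt_curve (θ : ℝ) : HasDerivAt K.curve (K.tangent θ) θ :=
  (K.differentiable_curve θ).hasDerivAt

/-- **The velocity of a knot never vanishes**: `γ' (θ) ≠ 0`, since
`γ = (K : 𝕊¹ → ℝ⁴) ∘ circlePoint` with both differentials injective. Hirsch (1976), §1.3
(immersions). [folklore] -/
theorem tangent_ne_zero (θ : ℝ) : K.tangent θ ≠ 0 := by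
  intro h0
  have hn : (∞ : WithTop ℕ∞) ≠ 0 := by simp
  have hcomp : mfderiv 𝓘(ℝ, ℝ) 𝓘(ℝ, 𝔼 4) ((fun u : 𝕊 1 ↦ ((K u : 𝕊 3) : 𝔼 4)) ∘ circlePoint) θ =
      (mfderiv (𝓡 1) 𝓘(ℝ, 𝔼 4) (fun u : 𝕊 1 ↦ ((K u : 𝕊 3) : 𝔼 4)) (circlePoint θ)).comp
        (mfderiv 𝓘(ℝ, ℝ) (𝓡 1) circlePoint θ) :=
    mfderiv_comp θ (K.contMDiff_coe_comp.mdifferentiableAt hn)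
      (contMDiff_circlePoint.mdifferentiableAt hn)
  have h1 : mfderiv 𝓘(ℝ, ℝ) 𝓘(ℝ, 𝔼 4) ((fun u : 𝕊 1 ↦ ((K u : 𝕊 3) : 𝔼 4)) ∘ circlePoint) θ
      (1 : ℝ) = 0 := by
    rw [mfderiv_eq_fderiv]
    exact h0
  rw [hcomp] at h1
  have h2 : mfderiv 𝓘(ℝ, ℝ) (𝓡 1) circlePoint θ (1 : ℝ) = 0 :=
    K.mfderiv_coe_comp_injective (circlePoint θ) (by rw [map_zero]; exact h1)
  exact mfderiv_circlePoint_apply_ne_zero θ h2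

/-- The velocity of a knot is smooth. [folklore] -/
theorem contDiff_tangent : ContDiff ℝ ∞ K.tangent := by
  rw [show K.tangent = deriv K.curve from rfl]
  exact (contDiff_infty_iff_deriv.1 K.contDiff_curve).2

/-- The velocity of a knot is continuous. [folklore] -/
@[continuity, fun_prop]
theorem continuous_tangent : Continuous K.tangent := K.contDiff_tangent.continuous

/-- The velocity of a knot is `2π`-periodic. [folklore] -/
theorem periodic_tangent : Periodic K.tangent (2 * Real.pi) := fun θ ↦ by
  rw [tangent_apply, tangent_apply, ← deriv_comp_add_const]
  congr 1
  funext t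
  exact K.periodic_curve t

/-- The velocity of a knot is tangent to the sphere: `⟪γ', γ⟫ = 0` (differentiate
`‖γ‖² = 1`). [folklore] -/
theorem inner_tangent_curve (θ : ℝ) : ⟪K.tangent θ, K.curve θ⟫ = 0 := by
  have h := (K.hasDerivAt_curve θ).norm_sq
  have hconst : (fun t ↦ ‖K.curve t‖ ^ 2) = fun _ ↦ (1 : ℝ) := by
    funext t; rw [norm_curve, one_pow]
  rw [hconst] at h
  have := (hasDerivAt_const θ (1 : ℝ)).unique h
  rw [real_inner_comm]
  linarith

end SphereEmbedding


/-! ### The normal framing of a knot -/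

/-- The cross product of two smooth curves in `ℝ³` is smooth. [folklore] -/
theorem contDiff_cross {n : WithTop ℕ∞} {v w : ℝ → Fin 3 → ℝ} (hv : ContDiff ℝ n v)
    (hw : ContDiff ℝ n w) : ContDiff ℝ n fun θ ↦ v θ ⨯₃ w θ := by
  have hvc : ∀ i : Fin 3, ContDiff ℝ n fun θ ↦ v θ i := fun i ↦ contDiff_pi.1 hv i
  have hwc : ∀ i : Fin 3, ContDiff ℝ n fun θ ↦ w θ i := fun i ↦ contDiff_pi.1 hw i
  rw [contDiff_pi]
  intro j
  fin_cases j <;> simp [cross_apply] <;> fun_prop (disch := assumption)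

namespace SphereEmbedding

variable (K : Knot)

attribute [local instance] fact_finrank_euclideanSpace_two fact_finrank_euclideanSpace_four

/-- The coordinates `v (θ) ∈ ℝ³` of the velocity of a knot in the parallelisation
`(X₁ γ, X₂ γ, X₃ γ)` of `T_γ 𝕊³`. [folklore] -/
def frameVec (θ : ℝ) : Fin 3 → ℝ := frameCoords (K.curve θ) (K.tangent θ)

/-- Unfolding of `frameVec`. [folklore] -/
theorem frameVec_def (θ : ℝ) : K.frameVec θ = frameCoords (K.curve θ) (K.tangent θ) := rfl

/-- The velocity of a knot is the frame combination of its coordinates: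
`γ' = Σᵢ vᵢ Xᵢ γ` (`γ' ⊥ γ`, `‖γ‖ = 1`). [folklore] -/
theorem tangent_eq_frameComb (θ : ℝ) : K.tangent θ = frameComb (K.curve θ) (K.frameVec θ) :=
  eq_frameComb_frameCoords (K.norm_curve θ) (K.inner_tangent_curve θ)

/-- The coordinates of the velocity never vanish. [folklore] -/
theorem frameVec_ne_zero (θ : ℝ) : K.frameVec θ ≠ 0 := fun h ↦ K.tangent_ne_zero θ (by
  rw [K.tangent_eq_frameComb θ, h]
  ext j
  simp)

/-- The coordinates of the velocity are smooth. [folklore] -/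
theorem contDiff_frameVec : ContDiff ℝ ∞ K.frameVec :=
  contDiff_frameCoords K.contDiff_curve K.contDiff_tangent

/-- The coordinates of the velocity are `2π`-periodic. [folklore] -/
theorem periodic_frameVec : Periodic K.frameVec (2 * Real.pi) := fun θ ↦ by
  rw [frameVec_def, frameVec_def, K.periodic_curve θ, K.periodic_tangent θ]

/-- There is a direction `e ∈ ℝ³` nowhere parallel to the velocity coordinates of the knot
(`exists_forall_cross_ne_zero`, Sard). [folklore] -/
theorem exists_forall_frameVec_cross_ne_zero : ∃ e : Fin 3 → ℝ, ∀ θ, K.frameVec θ ⨯₃ e ≠ 0 :=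
  exists_forall_cross_ne_zero (K.contDiff_frameVec.of_le (by simp)) K.frameVec_ne_zero

/-- A chosen direction `e ∈ ℝ³` nowhere parallel to the velocity coordinates. [folklore] -/
def pole : Fin 3 → ℝ := Classical.choose K.exists_forall_frameVec_cross_ne_zero

/-- The defining property of `pole`. [folklore] -/
theorem frameVec_cross_pole_ne_zero (θ : ℝ) : K.frameVec θ ⨯₃ K.pole ≠ 0 :=
  Classical.choose_spec K.exists_forall_frameVec_cross_ne_zero θ

/-- Frame coordinates `v × e` of the first normal vector. [folklore] -/
def normalCoords₁ (θ : ℝ) : Fin 3 → ℝ := K.frameVec θ ⨯₃ K.pole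

/-- Frame coordinates `v × (v × e)` of the second normal vector. [folklore] -/
def normalCoords₂ (θ : ℝ) : Fin 3 → ℝ := K.frameVec θ ⨯₃ K.normalCoords₁ θ

/-- Unfolding of `normalCoords₁`. [folklore] -/
theorem normalCoords₁_def (θ : ℝ) : K.normalCoords₁ θ = K.frameVec θ ⨯₃ K.pole := rfl

/-- Unfolding of `normalCoords₂`. [folklore] -/
theorem normalCoords₂_def (θ : ℝ) : K.normalCoords₂ θ = K.frameVec θ ⨯₃ K.normalCoords₁ θ := rfl

/-- **Orientation of the framing in coordinates**: `det (v, v × e, v × (v × e)) > 0`.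
[folklore] -/
theorem det_frameVec_normalCoords_pos (θ : ℝ) :
    0 < Matrix.det ![K.frameVec θ, K.normalCoords₁ θ, K.normalCoords₂ θ] :=
  det_cross_cross_pos (K.frameVec_cross_pole_ne_zero θ)

/-- The first normal coordinates are smooth. [folklore] -/
theorem contDiff_normalCoords₁ : ContDiff ℝ ∞ K.normalCoords₁ :=
  contDiff_cross K.contDiff_frameVec contDiff_const

/-- The second normal coordinates are smooth. [folklore] -/
theorem contDiff_normalCoords₂ : ContDiff ℝ ∞ K.normalCoords₂ :=
  contDiff_cross K.contDiff_frameVec K.contDiff_normalCoords₁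

/-- The first normal coordinates are `2π`-periodic. [folklore] -/
theorem periodic_normalCoords₁ : Periodic K.normalCoords₁ (2 * Real.pi) := fun θ ↦ by
  rw [normalCoords₁_def, normalCoords₁_def, K.periodic_frameVec θ]

/-- The second normal coordinates are `2π`-periodic. [folklore] -/
theorem periodic_normalCoords₂ : Periodic K.normalCoords₂ (2 * Real.pi) := fun θ ↦ by
  rw [normalCoords₂_def, normalCoords₂_def, K.periodic_frameVec θ, K.periodic_normalCoords₁ θ]

/-- **The first normal vector field** `N₁ = Σᵢ (v × e)ᵢ Xᵢ γ` along the knot in `𝕊³`.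
Hirsch (1976), §4.5 (a field of transverse planes). [folklore] -/
def normal₁ (θ : ℝ) : EuclideanSpace ℝ (Fin 4) := frameComb (K.curve θ) (K.normalCoords₁ θ)

/-- **The second normal vector field** `N₂ = Σᵢ (v × (v × e))ᵢ Xᵢ γ` along the knot in `𝕊³`.
Hirsch (1976), §4.5. [folklore] -/
def normal₂ (θ : ℝ) : EuclideanSpace ℝ (Fin 4) := frameComb (K.curve θ) (K.normalCoords₂ θ)

/-- Unfolding of `normal₁`. [folklore] -/
theorem normal₁_def (θ : ℝ) : K.normal₁ θ = frameComb (K.curve θ) (K.normalCoords₁ θ) := rfl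

/-- Unfolding of `normal₂`. [folklore] -/
theorem normal₂_def (θ : ℝ) : K.normal₂ θ = frameComb (K.curve θ) (K.normalCoords₂ θ) := rfl

/-- The first normal field is smooth. [folklore] -/
theorem contDiff_normal₁ : ContDiff ℝ ∞ K.normal₁ := contDiff_frameComb K.contDiff_curve K.contDiff_normalCoords₁

/-- The second normal field is smooth. [folklore] -/
theorem contDiff_normal₂ : ContDiff ℝ ∞ K.normal₂ := contDiff_frameComb K.contDiff_curve K.contDiff_normalCoords₂

/-- The first normal field is continuous. [folklore] -/
@[continuity, fun_prop]
theorem continuous_normal₁ : Continuous K.normal₁ := K.contDiff_normal₁.continuous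

/-- The second normal field is continuous. [folklore] -/
@[continuity, fun_prop]
theorem continuous_normal₂ : Continuous K.normal₂ := K.contDiff_normal₂.continuous

/-- The first normal field is `2π`-periodic. [folklore] -/
theorem periodic_normal₁ : Periodic K.normal₁ (2 * Real.pi) := fun θ ↦ by
  rw [normal₁_def, normal₁_def, K.periodic_curve θ, K.periodic_normalCoords₁ θ]

/-- The second normal field is `2π`-periodic. [folklore] -/
theorem periodic_normal₂ : Periodic K.normal₂ (2 * Real.pi) := fun θ ↦ by
  rw [normal₂_def, normal₂_def, K.periodic_curve θ, K.periodic_normalCoords₂ θ]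

/-- The first normal field is orthogonal to the position vector (tangent to `𝕊³`). [folklore] -/
@[simp] theorem inner_normal₁_curve (θ : ℝ) : ⟪K.normal₁ θ, K.curve θ⟫ = 0 :=
  inner_frameComb_left _ _

/-- The second normal field is orthogonal to the position vector (tangent to `𝕊³`). [folklore] -/
@[simp] theorem inner_normal₂_curve (θ : ℝ) : ⟪K.normal₂ θ, K.curve θ⟫ = 0 :=
  inner_frameComb_left _ _

/-- **The framing is positively oriented**: `det (γ, γ', N₁, N₂) > 0` at every parameter —
`= det (v, v × e, v × (v × e)) ‖γ‖⁴` by `frameDet_frameComb`. This is the pointwise linear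
algebra behind "the normal bundle of a knot in `S³` is trivial" (Hirsch (1976), §4.4 Ex. 2)
together with the orientation normalisation of `Literature.Topology.FourManifolds.Knot.TubularNbhd.det_pos`. [folklore] -/
theorem frameDet_curve_tangent_normal_pos (θ : ℝ) :
    0 < frameDet (K.curve θ) (K.tangent θ) (K.normal₁ θ) (K.normal₂ θ) := by
  rw [K.tangent_eq_frameComb θ, normal₁_def, normal₂_def, frameDet_frameComb, K.norm_curve]
  simpa using K.det_frameVec_normalCoords_pos θ

/-- In particular `γ', N₁, N₂` are linearly independent at every parameter. [folklore] -/
theorem frameDet_curve_tangent_normal_ne_zero (θ : ℝ) :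
    frameDet (K.curve θ) (K.tangent θ) (K.normal₁ θ) (K.normal₂ θ) ≠ 0 :=
  (K.frameDet_curve_tangent_normal_pos θ).ne'

end SphereEmbedding


/-! ## Part II. The tube over the knot: Hirsch's map `(x + y) / ‖x + y‖` and its Jacobian -/
/-! ### Scaled basis vectors of `ℝ²` -/

/-- `single i s = s • single i 1` in `ℝ²`. [folklore] -/
theorem euclideanSpace_single_eq_smul (i : Fin 2) (s : ℝ) :
    EuclideanSpace.single i s = s • EuclideanSpace.single i (1 : ℝ) := by
  ext j
  by_cases h : j = i <;> simp [h]

/-- Decomposition of a vector of `ℝ²` in the standard basis. [folklore] -/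
theorem euclideanSpace_two_decomp (w : 𝔼 2) :
    w = w 0 • EuclideanSpace.single 0 (1 : ℝ) + w 1 • EuclideanSpace.single 1 (1 : ℝ) := by
  ext j
  fin_cases j <;> simp

/-- Decomposition of a vector of `ℝ × ℝ²` in the standard basis. [folklore] -/
theorem real_prod_euclideanSpace_two_decomp (x : ℝ × 𝔼 2) :
    x = x.1 • ((1 : ℝ), (0 : 𝔼 2)) + x.2 0 • ((0 : ℝ), EuclideanSpace.single 0 (1 : ℝ))
      + x.2 1 • ((0 : ℝ), EuclideanSpace.single 1 (1 : ℝ)) := by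
  refine Prod.ext ?_ ?_
  · simp
  · simp only [Prod.snd_add, Prod.smul_snd, smul_zero, zero_add]
    exact euclideanSpace_two_decomp x.2

/-! ### The Jacobian frame of a map `ℝ × ℝ² → ℝ⁴` -/

section TubeFrame

variable (G : ℝ × 𝔼 2 → 𝔼 4)

/-- The **Jacobian frame determinant** `det (G, ∂_θ G, ∂_{w₀} G, ∂_{w₁} G)` of a map
`G : ℝ × ℝ² → ℝ⁴` at a point: position vector first, then the three partial derivatives
(the determinant of `Literature.Topology.FourManifolds.Knot.TubularNbhd.det_pos`, see `tubeFrameDet_eq_det_deriv`). [folklore] -/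
def tubeFrameDet (q : ℝ × 𝔼 2) : ℝ :=
  frameDet (G q) (fderiv ℝ G q (1, 0)) (fderiv ℝ G q (0, EuclideanSpace.single 0 1))
    (fderiv ℝ G q (0, EuclideanSpace.single 1 1))

/-- Unfolding of `tubeFrameDet`. [folklore] -/
theorem tubeFrameDet_def (q : ℝ × 𝔼 2) : tubeFrameDet G q =
    frameDet (G q) (fderiv ℝ G q (1, 0)) (fderiv ℝ G q (0, EuclideanSpace.single 0 1))
      (fderiv ℝ G q (0, EuclideanSpace.single 1 1)) := rfl

variable {G}

/-- The Jacobian frame determinant of a `C¹` map is continuous. [folklore] -/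
theorem continuous_tubeFrameDet (hG : ContDiff ℝ 1 G) : Continuous (tubeFrameDet G) := by
  have hc : Continuous (fderiv ℝ G) := hG.continuous_fderiv one_ne_zero
  unfold tubeFrameDet
  exact continuous_frameDet hG.continuous (hc.clm_apply continuous_const)
    (hc.clm_apply continuous_const) (hc.clm_apply continuous_const)

/-- The `θ`-derivative of `G` along `w = const` is the Fréchet derivative on `(1, 0)`.
[folklore] -/
theorem deriv_fst_eq_fderiv {θ : ℝ} {w : 𝔼 2} (hG : DifferentiableAt ℝ G (θ, w)) :
    deriv (fun t ↦ G (t, w)) θ = fderiv ℝ G (θ, w) (1, 0) := by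
  have hc : HasDerivAt (fun t : ℝ ↦ (t, w)) ((1 : ℝ), (0 : 𝔼 2)) θ :=
    (hasDerivAt_id θ).prodMk (hasDerivAt_const θ w)
  exact (hG.hasFDerivAt.comp_hasDerivAt θ hc).deriv

/-- The directional derivative of `G` in the fibre direction `eᵢ` is the Fréchet derivative on
`(0, eᵢ)`. [folklore] -/
theorem deriv_snd_eq_fderiv {θ : ℝ} {w : 𝔼 2} (hG : DifferentiableAt ℝ G (θ, w)) (i : Fin 2) :
    deriv (fun s ↦ G (θ, w + EuclideanSpace.single i s)) 0 =
      fderiv ℝ G (θ, w) (0, EuclideanSpace.single i 1) := by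
  have hc : HasDerivAt (fun s : ℝ ↦ (θ, w + s • EuclideanSpace.single i (1 : ℝ)))
      ((0 : ℝ), EuclideanSpace.single i (1 : ℝ)) 0 := by
    have h1 : HasDerivAt (fun s : ℝ ↦ w + s • EuclideanSpace.single i (1 : ℝ))
        (EuclideanSpace.single i (1 : ℝ)) 0 := by
      simpa using ((hasDerivAt_id (0 : ℝ)).smul_const (EuclideanSpace.single i (1 : ℝ))).const_add w
    exact (hasDerivAt_const (0 : ℝ) θ).prodMk h1
  have hfun : (fun s ↦ G (θ, w + EuclideanSpace.single i s)) =
      G ∘ fun s : ℝ ↦ (θ, w + s • EuclideanSpace.single i (1 : ℝ)) := by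
    funext s
    simp only [comp_apply, ← euclideanSpace_single_eq_smul]
  have hG' : HasFDerivAt G (fderiv ℝ G (θ, w)) (θ, w + (0 : ℝ) • EuclideanSpace.single i (1 : ℝ)) := by
    rw [zero_smul, add_zero]; exact hG.hasFDerivAt
  rw [hfun, (hG'.comp_hasDerivAt (0 : ℝ) hc).deriv]

/-- `tubeFrameDet G (θ, w)` is the determinant of `Literature.Topology.FourManifolds.Knot.TubularNbhd.det_pos` for the map
`(t, w) ↦ G (t, w)`. [folklore] -/
theorem tubeFrameDet_eq_det_deriv (hG : Differentiable ℝ G) (θ : ℝ) (w : 𝔼 2) :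
    tubeFrameDet G (θ, w) = Matrix.det (Matrix.of
      ![⇑(G (θ, w)),
        ⇑(deriv (fun t : ℝ ↦ G (t, w)) θ),
        ⇑(deriv (fun s : ℝ ↦ G (θ, w + EuclideanSpace.single 0 s)) 0),
        ⇑(deriv (fun s : ℝ ↦ G (θ, w + EuclideanSpace.single 1 s)) 0)]) := by
  rw [tubeFrameDet_def, frameDet_eq, deriv_fst_eq_fderiv (hG _), deriv_snd_eq_fderiv (hG _),
    deriv_snd_eq_fderiv (hG _)]

/-- **Nonvanishing Jacobian frame determinant implies injective differential.** If
`det (G, ∂_θ G, ∂₀ G, ∂₁ G) ≠ 0` at `q` then `fderiv ℝ G q : ℝ × ℝ² → ℝ⁴` is injective (its values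
on a basis are linearly independent). [folklore] -/
theorem fderiv_injective_of_tubeFrameDet_ne_zero {q : ℝ × 𝔼 2} (h : tubeFrameDet G q ≠ 0) :
    Injective (fderiv ℝ G q) := by
  set L := fderiv ℝ G q
  refine (injective_iff_map_eq_zero L).2 fun x hx ↦ ?_
  rw [real_prod_euclideanSpace_two_decomp x, map_add, map_add, map_smul, map_smul, map_smul]
    at hx
  obtain ⟨h1, h2, h3⟩ := eq_zero_of_frameDet_ne_zero h hx
  rw [real_prod_euclideanSpace_two_decomp x, h1, h2, h3]
  simp

/-- The Jacobian frame determinant of a map `2π`-periodic in `θ` is `2π`-periodic in `θ`.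
[folklore] -/
theorem tubeFrameDet_add_two_pi (hper : ∀ θ w, G (θ + 2 * Real.pi, w) = G (θ, w)) (θ : ℝ)
    (w : 𝔼 2) : tubeFrameDet G (θ + 2 * Real.pi, w) = tubeFrameDet G (θ, w) := by
  have hfun : (fun q : ℝ × 𝔼 2 ↦ G (q + ((2 * Real.pi : ℝ), (0 : 𝔼 2)))) = G := by
    funext q
    rw [show q + ((2 * Real.pi : ℝ), (0 : 𝔼 2)) = (q.1 + 2 * Real.pi, q.2) by
      ext <;> simp]
    exact hper q.1 q.2
  have hf : fderiv ℝ G (θ + 2 * Real.pi, w) = fderiv ℝ G (θ, w) := by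
    conv_rhs => rw [← hfun]
    rw [fderiv_comp_add_right, Prod.mk_add_mk, add_zero]
  rw [tubeFrameDet_def, tubeFrameDet_def, hf, hper]

end TubeFrame

/-! ### The squeeze map of `ℝ²` onto a disc -/

section Squeeze

/-- The factor `ρ (w) = (1 + ‖w‖²)^{-1/2}`. [folklore] -/
def squeezeFactor (w : 𝔼 2) : ℝ := (√(1 + ‖w‖ ^ 2))⁻¹

/-- Unfolding of `squeezeFactor`. [folklore] -/
theorem squeezeFactor_def (w : 𝔼 2) : squeezeFactor w = (√(1 + ‖w‖ ^ 2))⁻¹ := rfl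

/-- `1 + ‖w‖² > 0`. [folklore] -/
theorem one_add_norm_sq_pos (w : 𝔼 2) : 0 < 1 + ‖w‖ ^ 2 := by positivity

/-- The squeeze factor is positive. [folklore] -/
theorem squeezeFactor_pos (w : 𝔼 2) : 0 < squeezeFactor w :=
  inv_pos.2 (Real.sqrt_pos.2 (one_add_norm_sq_pos w))

/-- `ρ² (1 + ‖w‖²) = 1`. [folklore] -/
theorem squeezeFactor_sq_mul (w : 𝔼 2) : squeezeFactor w ^ 2 * (1 + ‖w‖ ^ 2) = 1 := by
  rw [squeezeFactor_def, inv_pow, Real.sq_sqrt (one_add_norm_sq_pos w).le,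
    inv_mul_cancel₀ (one_add_norm_sq_pos w).ne']

/-- `ρ (0) = 1`. [folklore] -/
@[simp] theorem squeezeFactor_zero : squeezeFactor 0 = 1 := by
  simp [squeezeFactor_def]

/-- The squeeze factor is smooth. [folklore] -/
theorem contDiff_squeezeFactor : ContDiff ℝ ∞ squeezeFactor := by
  have h1 : ContDiff ℝ ∞ fun w : 𝔼 2 ↦ 1 + ‖w‖ ^ 2 := contDiff_const.add (contDiff_norm_sq ℝ)
  exact (h1.sqrt fun w ↦ (one_add_norm_sq_pos w).ne').inv fun w ↦
    (Real.sqrt_pos.2 (one_add_norm_sq_pos w)).ne'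

/-- **The squeeze map** `σ_δ (w) = δ (1 + ‖w‖²)^{-1/2} w`, a diffeomorphism of `ℝ²` onto the open
disc of radius `δ` (Hirsch's "a partial tubular neighbourhood contains a full one by
reparametrising the fibres", §4.5; Mathlib's `OpenPartialHomeomorph.univBall` is the same map, here
kept explicit for its Jacobian). [folklore] -/
def squeeze (δ : ℝ) (w : 𝔼 2) : 𝔼 2 := (δ * squeezeFactor w) • w

/-- Unfolding of `squeeze`. [folklore] -/
theorem squeeze_def (δ : ℝ) (w : 𝔼 2) : squeeze δ w = (δ * squeezeFactor w) • w := rfl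

/-- The squeeze map fixes the origin. [folklore] -/
@[simp] theorem squeeze_zero (δ : ℝ) : squeeze δ 0 = 0 := by simp [squeeze_def]

/-- The squeeze map is smooth. [folklore] -/
theorem contDiff_squeeze (δ : ℝ) : ContDiff ℝ ∞ (squeeze δ) :=
  (contDiff_const.mul contDiff_squeezeFactor).smul contDiff_id

/-- `‖σ_δ w‖ = δ ‖w‖ / √(1 + ‖w‖²)`. [folklore] -/
theorem norm_squeeze {δ : ℝ} (hδ : 0 ≤ δ) (w : 𝔼 2) :
    ‖squeeze δ w‖ = δ * squeezeFactor w * ‖w‖ := by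
  rw [squeeze_def, norm_smul, Real.norm_eq_abs, abs_of_nonneg (mul_nonneg hδ (squeezeFactor_pos w).le)]

/-- The squeeze map takes values in the open disc of radius `δ`. [folklore] -/
theorem norm_squeeze_lt {δ : ℝ} (hδ : 0 < δ) (w : 𝔼 2) : ‖squeeze δ w‖ < δ := by
  rw [norm_squeeze hδ.le, mul_assoc]
  refine mul_lt_of_lt_one_right hδ ?_
  have h1 : squeezeFactor w * ‖w‖ < squeezeFactor w * √(1 + ‖w‖ ^ 2) := by
    refine mul_lt_mul_of_pos_left ?_ (squeezeFactor_pos w)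
    rw [Real.lt_sqrt (norm_nonneg w)]
    linarith
  rwa [squeezeFactor_def, inv_mul_cancel₀ (Real.sqrt_pos.2 (one_add_norm_sq_pos w)).ne'] at h1

/-- The squeeze map is injective: `r ↦ r / √(1 + r²)` is injective on norms. [folklore] -/
theorem squeeze_injective {δ : ℝ} (hδ : 0 < δ) : Injective (squeeze δ) := by
  intro w w' h
  have hn : ‖squeeze δ w‖ = ‖squeeze δ w'‖ := by rw [h]
  rw [norm_squeeze hδ.le, norm_squeeze hδ.le, mul_assoc, mul_assoc] at hn
  have hn' := mul_left_cancel₀ hδ.ne' hn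
  -- `ρ(w) ‖w‖ = ρ(w') ‖w'‖` forces `‖w‖ = ‖w'‖`
  have hsq : ∀ v : 𝔼 2, (squeezeFactor v * ‖v‖) ^ 2 * (1 + ‖v‖ ^ 2) = ‖v‖ ^ 2 := fun v ↦ by
    rw [mul_pow]; nlinarith [squeezeFactor_sq_mul v]
  have hnorm : ‖w‖ ^ 2 = ‖w'‖ ^ 2 := by
    have h1 := hsq w
    have h2 := hsq w'
    rw [hn'] at h1
    nlinarith [sq_nonneg (squeezeFactor w' * ‖w'‖), norm_nonneg w, norm_nonneg w']
  have hρ : squeezeFactor w = squeezeFactor w' := by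
    rw [squeezeFactor_def, squeezeFactor_def, hnorm]
  rw [squeeze_def, squeeze_def, hρ] at h
  exact smul_right_injective _ (mul_ne_zero hδ.ne' (squeezeFactor_pos w').ne') h

/-- Derivative of the scalar profile `u ↦ δ / √(1 + u)` of the squeeze map. [folklore] -/
theorem hasDerivAt_squeezeProfile (δ : ℝ) {u : ℝ} (hu : 0 < 1 + u) :
    HasDerivAt (fun u : ℝ ↦ δ * (√(1 + u))⁻¹) (-(δ / 2) * (√(1 + u))⁻¹ ^ 3) u := by
  have hs : 0 < √(1 + u) := Real.sqrt_pos.2 hu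
  have h1 : HasDerivAt (fun u : ℝ ↦ 1 + u) 1 u := (hasDerivAt_id u).const_add 1
  have h2 := h1.sqrt hu.ne'
  have h3 := h2.fun_inv hs.ne'
  have h4 := h3.const_mul δ
  refine h4.congr_deriv ?_
  field_simp

/-- The differential of the squeeze map, as a continuous linear map:
`Dσ_δ (w) h = δρ h - δρ³ ⟪w, h⟫ w` with `ρ = (1 + ‖w‖²)^{-1/2}`. [folklore] -/
def squeezeFDeriv (δ : ℝ) (w : 𝔼 2) : 𝔼 2 →L[ℝ] 𝔼 2 :=
  (δ * squeezeFactor w) • ContinuousLinearMap.id ℝ (𝔼 2) +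
    (-(δ * squeezeFactor w ^ 3)) • (innerSL ℝ w).smulRight w

/-- `squeezeFDeriv` applied to a vector. [folklore] -/
theorem squeezeFDeriv_apply (δ : ℝ) (w h : 𝔼 2) :
    squeezeFDeriv δ w h = (δ * squeezeFactor w) • h + (-(δ * squeezeFactor w ^ 3 * ⟪w, h⟫)) • w := by
  simp only [squeezeFDeriv, add_apply, smul_apply, ContinuousLinearMap.id_apply,
    ContinuousLinearMap.smulRight_apply, innerSL_apply_apply, smul_smul]
  congr 1
  rw [neg_mul]

/-- **The differential of the squeeze map** is `squeezeFDeriv`. [folklore] -/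
theorem hasFDerivAt_squeeze (δ : ℝ) (w : 𝔼 2) : HasFDerivAt (squeeze δ) (squeezeFDeriv δ w) w := by
  have hn : HasFDerivAt (fun w : 𝔼 2 ↦ ‖w‖ ^ 2) (2 • innerSL ℝ w) w :=
    (hasStrictFDerivAt_norm_sq w).hasFDerivAt
  have hc' := (hasDerivAt_squeezeProfile δ (one_add_norm_sq_pos w)).comp_hasFDerivAt w hn
  have hc : HasFDerivAt (fun w : 𝔼 2 ↦ δ * squeezeFactor w)
      ((-(δ / 2) * (√(1 + ‖w‖ ^ 2))⁻¹ ^ 3) • (2 • innerSL ℝ w)) w := hc'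
  have h := hc.smul (hasFDerivAt_id w)
  refine h.congr_fderiv ?_
  ext v j
  rw [squeezeFDeriv_apply]
  simp only [add_apply, smul_apply, ContinuousLinearMap.id_apply,
    ContinuousLinearMap.smulRight_apply, innerSL_apply_apply, id_eq, PiLp.add_apply,
    PiLp.smul_apply, smul_eq_mul, nsmul_eq_mul, Nat.cast_ofNat, squeezeFactor_def]
  ring

/-- The differential of the squeeze map on a basis vector:
`Dσ eᵢ = δρ eᵢ - δρ³ wᵢ w`. [folklore] -/
theorem squeezeFDeriv_single (δ : ℝ) (w : 𝔼 2) (i : Fin 2) :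
    squeezeFDeriv δ w (EuclideanSpace.single i 1) =
      (δ * squeezeFactor w) • EuclideanSpace.single i 1 + (-(δ * squeezeFactor w ^ 3 * w i)) • w := by
  rw [squeezeFDeriv_apply, EuclideanSpace.inner_single_right]
  simp

/-- Matrix entries of the differential of the squeeze map in the standard basis:
`Dσ eᵢ = Σⱼ M i j • eⱼ` with `M i j = δρ δᵢⱼ - δρ³ wᵢ wⱼ`. [folklore] -/
def squeezeMatrix (δ : ℝ) (w : 𝔼 2) (i j : Fin 2) : ℝ :=
  (if i = j then δ * squeezeFactor w else 0) - δ * squeezeFactor w ^ 3 * w i * w j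

/-- The differential of the squeeze map on `eᵢ` in the standard basis. [folklore] -/
theorem squeezeFDeriv_single_eq (δ : ℝ) (w : 𝔼 2) (i : Fin 2) :
    squeezeFDeriv δ w (EuclideanSpace.single i 1) =
      squeezeMatrix δ w i 0 • EuclideanSpace.single 0 1 +
        squeezeMatrix δ w i 1 • EuclideanSpace.single 1 1 := by
  rw [squeezeFDeriv_single]
  ext j
  fin_cases i <;> fin_cases j <;> simp [squeezeMatrix] <;> ring

/-- **The Jacobian of the squeeze map is positive**: `det Dσ_δ (w) = δ² ρ⁴ > 0`. [folklore] -/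
theorem squeezeMatrix_det_pos {δ : ℝ} (hδ : 0 < δ) (w : 𝔼 2) :
    0 < squeezeMatrix δ w 0 0 * squeezeMatrix δ w 1 1 - squeezeMatrix δ w 0 1 * squeezeMatrix δ w 1 0 := by
  have hρ := squeezeFactor_pos w
  have hu := squeezeFactor_sq_mul w
  have hn : ‖w‖ ^ 2 = w 0 ^ 2 + w 1 ^ 2 := by
    rw [EuclideanSpace.norm_eq, Real.sq_sqrt (Finset.sum_nonneg fun i _ ↦ sq_nonneg _),
      Fin.sum_univ_two, Real.norm_eq_abs, Real.norm_eq_abs, sq_abs, sq_abs]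
  rw [hn] at hu
  have key : squeezeMatrix δ w 0 0 * squeezeMatrix δ w 1 1 -
      squeezeMatrix δ w 0 1 * squeezeMatrix δ w 1 0 = δ ^ 2 * squeezeFactor w ^ 4 := by
    simp only [squeezeMatrix, if_true, show (0 : Fin 2) ≠ 1 from by decide,
      show (1 : Fin 2) ≠ 0 from by decide, if_false]
    linear_combination (-(δ ^ 2 * squeezeFactor w ^ 2)) * hu
  rw [key]
  positivity

end Squeeze

/-! ### The tube over a knot -/

namespace SphereEmbedding

variable (K : SphereEmbedding 1 3)

attribute [local instance] fact_finrank_euclideanSpace_two fact_finrank_euclideanSpace_four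

/-- The un-normalised tube `(θ, w) ↦ γ θ + w₀ N₁ θ + w₁ N₂ θ ∈ ℝ⁴` over a knot: Hirsch's
`f (x, y) = x + y` on the field of normal planes spanned by the framing
(Hirsch (1976), §4.5, proof of Thm. 5.1). [cite: Hirsch1976, §4.5 Thm 5.1] -/
def tubeRaw (q : ℝ × 𝔼 2) : 𝔼 4 := K.curve q.1 + q.2 0 • K.normal₁ q.1 + q.2 1 • K.normal₂ q.1

/-- Unfolding of `tubeRaw`. [folklore] -/
theorem tubeRaw_apply (θ : ℝ) (w : 𝔼 2) :
    K.tubeRaw (θ, w) = K.curve θ + w 0 • K.normal₁ θ + w 1 • K.normal₂ θ := rfl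

/-- The un-normalised tube has unit component along the position vector. [folklore] -/
theorem inner_tubeRaw_curve (θ : ℝ) (w : 𝔼 2) : ⟪K.tubeRaw (θ, w), K.curve θ⟫ = 1 := by
  rw [tubeRaw_apply, inner_add_left, inner_add_left, inner_smul_left, inner_smul_left,
    inner_normal₁_curve, inner_normal₂_curve, real_inner_self_eq_norm_sq, norm_curve]
  simp

/-- The un-normalised tube never vanishes. [folklore] -/
theorem tubeRaw_ne_zero (q : ℝ × 𝔼 2) : K.tubeRaw q ≠ 0 := by
  obtain ⟨θ, w⟩ := q
  intro h
  have := K.inner_tubeRaw_curve θ w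
  rw [h, inner_zero_left] at this
  exact zero_ne_one this

/-- The norm of the un-normalised tube never vanishes. [folklore] -/
theorem norm_tubeRaw_ne_zero (q : ℝ × 𝔼 2) : ‖K.tubeRaw q‖ ≠ 0 :=
  norm_ne_zero_iff.2 (K.tubeRaw_ne_zero q)

/-- The un-normalised tube is smooth. [folklore] -/
theorem contDiff_tubeRaw : ContDiff ℝ ∞ K.tubeRaw := by
  have h0 : ContDiff ℝ ∞ fun q : ℝ × 𝔼 2 ↦ q.2 0 :=
    (EuclideanSpace.proj (0 : Fin 2) : 𝔼 2 →L[ℝ] ℝ).contDiff.comp contDiff_snd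
  have h1 : ContDiff ℝ ∞ fun q : ℝ × 𝔼 2 ↦ q.2 1 :=
    (EuclideanSpace.proj (1 : Fin 2) : 𝔼 2 →L[ℝ] ℝ).contDiff.comp contDiff_snd
  exact ((K.contDiff_curve.comp contDiff_fst).add
    (h0.smul (K.contDiff_normal₁.comp contDiff_fst))).add
    (h1.smul (K.contDiff_normal₂.comp contDiff_fst))

/-- On the zero section the un-normalised tube is the knot. [folklore] -/
@[simp] theorem tubeRaw_zero (θ : ℝ) : K.tubeRaw (θ, 0) = K.curve θ := by
  simp [tubeRaw_apply]

/-- The un-normalised tube is `2π`-periodic in `θ`. [folklore] -/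
theorem tubeRaw_add_two_pi (θ : ℝ) (w : 𝔼 2) :
    K.tubeRaw (θ + 2 * Real.pi, w) = K.tubeRaw (θ, w) := by
  rw [tubeRaw_apply, tubeRaw_apply, K.periodic_curve θ, K.periodic_normal₁ θ, K.periodic_normal₂ θ]

/-- The un-normalised tube along the first fibre axis. [folklore] -/
theorem tubeRaw_single_zero (θ s : ℝ) :
    K.tubeRaw (θ, EuclideanSpace.single 0 s) = K.curve θ + s • K.normal₁ θ := by
  simp [tubeRaw_apply]

/-- The un-normalised tube along the second fibre axis. [folklore] -/
theorem tubeRaw_single_one (θ s : ℝ) :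
    K.tubeRaw (θ, EuclideanSpace.single 1 s) = K.curve θ + s • K.normal₂ θ := by
  simp [tubeRaw_apply]

/-- **The tube map in coordinates** `(θ, w) ↦ (γ θ + w₀ N₁ θ + w₁ N₂ θ) / ‖…‖ ∈ 𝕊³ ⊆ ℝ⁴`:
Hirsch's `f (x, y) = x + y` followed by the retraction `ℝ⁴ ∖ 0 → 𝕊³`
(Hirsch (1976), §4.5, Thm. 5.1 and the proof of Thm. 5.2). [cite: Hirsch1976, §4.5 Thm 5.2] -/
def tube (q : ℝ × 𝔼 2) : 𝔼 4 := ‖K.tubeRaw q‖⁻¹ • K.tubeRaw q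

/-- Unfolding of `tube`. [folklore] -/
theorem tube_def (q : ℝ × 𝔼 2) : K.tube q = ‖K.tubeRaw q‖⁻¹ • K.tubeRaw q := rfl

/-- The tube map takes values in the unit sphere. [folklore] -/
@[simp] theorem norm_tube (q : ℝ × 𝔼 2) : ‖K.tube q‖ = 1 := by
  rw [tube_def, norm_smul, norm_inv, norm_norm, inv_mul_cancel₀ (K.norm_tubeRaw_ne_zero q)]

/-- The tube map is smooth. [folklore] -/
theorem contDiff_tube : ContDiff ℝ ∞ K.tube :=
  ((K.contDiff_tubeRaw.norm ℝ K.tubeRaw_ne_zero).inv K.norm_tubeRaw_ne_zero).smul K.contDiff_tubeRaw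

/-- The tube map is differentiable. [folklore] -/
theorem differentiable_tube : Differentiable ℝ K.tube := K.contDiff_tube.differentiable (by simp)

/-- The tube map is continuous. [folklore] -/
@[continuity, fun_prop]
theorem continuous_tube : Continuous K.tube := K.contDiff_tube.continuous

/-- On the zero section the tube map is the knot: `f (θ, 0) = γ θ = K (cos θ, sin θ)`. [folklore] -/
@[simp] theorem tube_zero (θ : ℝ) : K.tube (θ, 0) = K.curve θ := by
  rw [tube_def, tubeRaw_zero, norm_curve, inv_one, one_smul]

/-- The tube map is `2π`-periodic in `θ`. [folklore] -/
theorem tube_add_two_pi (θ : ℝ) (w : 𝔼 2) : K.tube (θ + 2 * Real.pi, w) = K.tube (θ, w) := by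
  rw [tube_def, tube_def, tubeRaw_add_two_pi]

/-- The `θ`-derivative of the tube map on the zero section is the velocity of the knot.
[folklore] -/
theorem fderiv_tube_zero_fst (θ : ℝ) : fderiv ℝ K.tube (θ, 0) (1, 0) = K.tangent θ := by
  rw [← deriv_fst_eq_fderiv (K.differentiable_tube _)]
  simp only [tube_zero]
  rfl

/-- The fibre derivatives of the tube map on the zero section are the normal fields up to a
multiple of the position vector: `∂ᵢ f (θ, 0) = c γ θ + Nᵢ θ`. [folklore] -/
theorem fderiv_tube_zero_snd (θ : ℝ) {i : Fin 2} {N : 𝔼 4}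
    (hN : ∀ s : ℝ, K.tubeRaw (θ, EuclideanSpace.single i s) = K.curve θ + s • N) :
    ∃ c : ℝ, fderiv ℝ K.tube (θ, 0) (0, EuclideanSpace.single i 1) = c • K.curve θ + N := by
  have hR : HasDerivAt (fun s : ℝ ↦ K.curve θ + s • N) N 0 := by
    simpa using ((hasDerivAt_id (0 : ℝ)).smul_const N).const_add (K.curve θ)
  have hR0 : (fun s : ℝ ↦ K.curve θ + s • N) 0 = K.curve θ := by simp
  have hR0' : (fun s : ℝ ↦ K.curve θ + s • N) 0 ≠ 0 := by
    rw [hR0]; intro h; have := K.norm_curve θ; rw [h, norm_zero] at this; exact zero_ne_one this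
  have hn : HasDerivAt (fun s : ℝ ↦ ‖K.curve θ + s • N‖) (deriv (fun s : ℝ ↦ ‖K.curve θ + s • N‖) 0) 0 :=
    (hR.differentiableAt.norm ℝ hR0').hasDerivAt
  have hinv := hn.fun_inv (by rw [zero_smul, add_zero, norm_curve]; exact one_ne_zero)
  have hprod := hinv.fun_smul hR
  refine ⟨-deriv (fun s : ℝ ↦ ‖K.curve θ + s • N‖) 0 / ‖K.curve θ + (0 : ℝ) • N‖ ^ 2, ?_⟩
  rw [← deriv_snd_eq_fderiv (K.differentiable_tube _)]
  have hfun : (fun s ↦ K.tube (θ, 0 + EuclideanSpace.single i s)) =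
      fun s ↦ ‖K.curve θ + s • N‖⁻¹ • (K.curve θ + s • N) := by
    funext s; rw [zero_add, tube_def, hN]
  rw [hfun, hprod.deriv, zero_smul, add_zero, norm_curve, inv_one, one_smul, add_comm]

/-- **The Jacobian frame determinant of the tube map on the zero section** is the framing
determinant `det (γ, γ', N₁, N₂)`. [folklore] -/
theorem tubeFrameDet_tube_zero (θ : ℝ) :
    tubeFrameDet K.tube (θ, 0) = frameDet (K.curve θ) (K.tangent θ) (K.normal₁ θ) (K.normal₂ θ) := by
  obtain ⟨c₁, h₁⟩ := K.fderiv_tube_zero_snd θ (i := 0) (K.tubeRaw_single_zero θ)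
  obtain ⟨c₂, h₂⟩ := K.fderiv_tube_zero_snd θ (i := 1) (K.tubeRaw_single_one θ)
  rw [tubeFrameDet_def, fderiv_tube_zero_fst, h₁, h₂, tube_zero, frameDet_add_smul]

/-- The Jacobian frame determinant of the tube map is positive on the zero section (Hirsch:
"`Tf` is the identity on the zero section"). [folklore] -/
theorem tubeFrameDet_tube_zero_pos (θ : ℝ) : 0 < tubeFrameDet K.tube (θ, 0) := by
  rw [tubeFrameDet_tube_zero]
  exact K.frameDet_curve_tangent_normal_pos θ

/-- **A tube of positive Jacobian.** There is `ε > 0` such that the Jacobian frame determinant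
of the tube map is positive on `ℝ × B (0, ε)`: it is continuous, positive on the compact zero
section `[0, 2π] × {0}` (tube lemma) and `2π`-periodic (Hirsch (1976), §4.5 Thm. 5.1: "`f` is an
immersion on a neighbourhood of the zero section"). [cite: Hirsch1976, §4.5 Thm 5.1] -/
theorem exists_tubeFrameDet_tube_pos :
    ∃ ε : ℝ, 0 < ε ∧ ∀ θ : ℝ, ∀ w : 𝔼 2, ‖w‖ < ε → 0 < tubeFrameDet K.tube (θ, w) := by
  set S : Set (ℝ × 𝔼 2) := {q | 0 < tubeFrameDet K.tube q} with hSdef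
  have hS : IsOpen S :=
    isOpen_lt continuous_const (continuous_tubeFrameDet (K.contDiff_tube.of_le (by simp)))
  have hsub : Icc 0 (2 * Real.pi) ×ˢ ({0} : Set (𝔼 2)) ⊆ S := by
    rintro ⟨θ, w⟩ ⟨-, hw⟩
    rw [mem_singleton_iff] at hw
    subst hw
    exact K.tubeFrameDet_tube_zero_pos θ
  obtain ⟨U, V, -, hV, hIU, h0V, hUV⟩ :=
    generalized_tube_lemma isCompact_Icc isCompact_singleton hS hsub
  obtain ⟨ε, hε, hball⟩ := Metric.isOpen_iff.1 hV 0 (h0V rfl)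
  refine ⟨ε, hε, fun θ w hw ↦ ?_⟩
  have hper : Periodic (fun t ↦ tubeFrameDet K.tube (t, w)) (2 * Real.pi) := fun t ↦
    tubeFrameDet_add_two_pi K.tube_add_two_pi t w
  obtain ⟨θ', hθ', heq⟩ := hper.exists_mem_Ico₀ Real.two_pi_pos θ
  have hmem : (θ', w) ∈ S := hUV ⟨hIU (Ico_subset_Icc_self hθ'), hball (by simpa using hw)⟩
  rw [heq]
  exact hmem

/-- **A radius of positive Jacobian** for the tube over `K` (some `ε > 0` as in
`exists_tubeFrameDet_tube_pos`). [folklore] -/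
def jacobiRadius : ℝ := Classical.choose K.exists_tubeFrameDet_tube_pos

/-- The radius of positive Jacobian is positive. [folklore] -/
theorem jacobiRadius_pos : 0 < K.jacobiRadius := (Classical.choose_spec K.exists_tubeFrameDet_tube_pos).1

/-- Within the radius of positive Jacobian the tube map has positive Jacobian frame determinant.
[folklore] -/
theorem tubeFrameDet_tube_pos {θ : ℝ} {w : 𝔼 2} (hw : ‖w‖ < K.jacobiRadius) :
    0 < tubeFrameDet K.tube (θ, w) :=
  (Classical.choose_spec K.exists_tubeFrameDet_tube_pos).2 θ w hw

/-! ### The squeezed tube -/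

/-- **The squeezed tube** `G_δ (θ, w) = f (θ, σ_δ w)`: the tube map precomposed with the squeeze of
`ℝ²` onto the disc of radius `δ` (a full tube inside a partial one, Hirsch (1976), §4.5, end of
the proof of Thm. 5.1). [cite: Hirsch1976, §4.5 Thm 5.1] -/
def tubeδ (δ : ℝ) (q : ℝ × 𝔼 2) : 𝔼 4 := K.tube (q.1, squeeze δ q.2)

/-- Unfolding of `tubeδ`. [folklore] -/
theorem tubeδ_apply (δ θ : ℝ) (w : 𝔼 2) : K.tubeδ δ (θ, w) = K.tube (θ, squeeze δ w) := rfl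

/-- The squeezed tube takes values in the unit sphere. [folklore] -/
@[simp] theorem norm_tubeδ (δ : ℝ) (q : ℝ × 𝔼 2) : ‖K.tubeδ δ q‖ = 1 := K.norm_tube _

/-- The squeezed tube is smooth. [folklore] -/
theorem contDiff_tubeδ (δ : ℝ) : ContDiff ℝ ∞ (K.tubeδ δ) :=
  K.contDiff_tube.comp (contDiff_fst.prodMk ((contDiff_squeeze δ).comp contDiff_snd))

/-- The squeezed tube is differentiable. [folklore] -/
theorem differentiable_tubeδ (δ : ℝ) : Differentiable ℝ (K.tubeδ δ) :=
  (K.contDiff_tubeδ δ).differentiable (by simp)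

/-- On the zero section the squeezed tube is the knot. [folklore] -/
@[simp] theorem tubeδ_zero (δ θ : ℝ) : K.tubeδ δ (θ, 0) = K.curve θ := by
  rw [tubeδ_apply, squeeze_zero, tube_zero]

/-- The squeezed tube is `2π`-periodic in `θ`. [folklore] -/
theorem tubeδ_add_two_pi (δ θ : ℝ) (w : 𝔼 2) : K.tubeδ δ (θ + 2 * Real.pi, w) = K.tubeδ δ (θ, w) := by
  rw [tubeδ_apply, tubeδ_apply, tube_add_two_pi]

/-- The squeezed tube is `2π`-periodic in `θ` (`Function.Periodic` form). [folklore] -/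
theorem periodic_tubeδ (δ : ℝ) (w : 𝔼 2) : Periodic (fun t ↦ K.tubeδ δ (t, w)) (2 * Real.pi) :=
  fun t ↦ K.tubeδ_add_two_pi δ t w

/-- **Chain rule for the squeezed tube**: `DG_δ (θ, w) = Df (θ, σ w) ∘ (id × Dσ (w))`.
[folklore] -/
theorem hasFDerivAt_tubeδ (δ θ : ℝ) (w : 𝔼 2) :
    HasFDerivAt (K.tubeδ δ) ((fderiv ℝ K.tube (θ, squeeze δ w)).comp
      ((ContinuousLinearMap.fst ℝ ℝ (𝔼 2)).prod
        ((squeezeFDeriv δ w).comp (ContinuousLinearMap.snd ℝ ℝ (𝔼 2))))) (θ, w) := by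
  have h2 : HasFDerivAt (squeeze δ ∘ Prod.snd)
      ((squeezeFDeriv δ w).comp (ContinuousLinearMap.snd ℝ ℝ (𝔼 2))) (θ, w) :=
    (hasFDerivAt_squeeze δ w).comp (θ, w) hasFDerivAt_snd
  have h1 := (hasFDerivAt_fst (p := (θ, w))).prodMk h2
  have h3 : HasFDerivAt K.tube (fderiv ℝ K.tube (θ, squeeze δ w)) (θ, squeeze δ w) :=
    (K.differentiable_tube _).hasFDerivAt
  exact h3.comp (θ, w) h1

/-- **Jacobian frame determinant of the squeezed tube**:
`det (G_δ, ∂G_δ) (θ, w) = det (Dσ_δ w) · det (f, ∂f) (θ, σ_δ w)`. [folklore] -/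
theorem tubeFrameDet_tubeδ (δ θ : ℝ) (w : 𝔼 2) :
    tubeFrameDet (K.tubeδ δ) (θ, w) =
      (squeezeMatrix δ w 0 0 * squeezeMatrix δ w 1 1 - squeezeMatrix δ w 0 1 * squeezeMatrix δ w 1 0)
        * tubeFrameDet K.tube (θ, squeeze δ w) := by
  rw [tubeFrameDet_def, tubeFrameDet_def, (K.hasFDerivAt_tubeδ δ θ w).fderiv, tubeδ_apply]
  simp only [ContinuousLinearMap.comp_apply, ContinuousLinearMap.prod_apply,
    ContinuousLinearMap.coe_fst', ContinuousLinearMap.coe_snd', map_zero, squeezeFDeriv_single_eq]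
  set L := fderiv ℝ K.tube (θ, squeeze δ w)
  have hlin : ∀ a b : ℝ, L (0, a • EuclideanSpace.single 0 (1 : ℝ) + b • EuclideanSpace.single 1 (1 : ℝ))
      = a • L (0, EuclideanSpace.single 0 1) + b • L (0, EuclideanSpace.single 1 1) := by
    intro a b
    rw [← map_smul, ← map_smul, ← map_add]
    congr 1
    ext <;> simp
  rw [hlin, hlin, frameDet_comb₂]

/-- **The squeezed tube is an immersion in coordinates**: for `0 < δ ≤ jacobiRadius`, the
Jacobian frame determinant of `G_δ` is positive everywhere. [folklore] -/
theorem tubeFrameDet_tubeδ_pos {δ : ℝ} (hδ : 0 < δ) (hδr : δ ≤ K.jacobiRadius) (q : ℝ × 𝔼 2) :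
    0 < tubeFrameDet (K.tubeδ δ) q := by
  obtain ⟨θ, w⟩ := q
  rw [tubeFrameDet_tubeδ]
  exact mul_pos (squeezeMatrix_det_pos hδ w)
    (K.tubeFrameDet_tube_pos ((norm_squeeze_lt hδ w).trans_le hδr))

/-- The differential of the squeezed tube is injective everywhere (`0 < δ ≤ jacobiRadius`).
[folklore] -/
theorem fderiv_tubeδ_injective {δ : ℝ} (hδ : 0 < δ) (hδr : δ ≤ K.jacobiRadius) (q : ℝ × 𝔼 2) :
    Injective (fderiv ℝ (K.tubeδ δ) q) :=
  fderiv_injective_of_tubeFrameDet_ne_zero (K.tubeFrameDet_tubeδ_pos hδ hδr q).ne'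

/-- The differential of the (unsqueezed) tube map is injective on the zero section. [folklore] -/
theorem fderiv_tube_zero_injective (θ : ℝ) : Injective (fderiv ℝ K.tube (θ, 0)) :=
  fderiv_injective_of_tubeFrameDet_ne_zero (K.tubeFrameDet_tube_zero_pos θ).ne'

/-- **Orientation of the squeezed tube** in the form of `Literature.Topology.FourManifolds.Knot.TubularNbhd.det_pos`: the
determinant of (position, `∂_θ`, `∂_{w₀}`, `∂_{w₁}`) of `(t, w) ↦ G_δ (t, w)` is positive at every
`(θ, w)`. [folklore] -/
theorem det_deriv_tubeδ_pos {δ : ℝ} (hδ : 0 < δ) (hδr : δ ≤ K.jacobiRadius) (θ : ℝ) (w : 𝔼 2) :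
    0 < Matrix.det (Matrix.of
      ![⇑(K.tubeδ δ (θ, w)),
        ⇑(deriv (fun t : ℝ ↦ K.tubeδ δ (t, w)) θ),
        ⇑(deriv (fun s : ℝ ↦ K.tubeδ δ (θ, w + EuclideanSpace.single 0 s)) 0),
        ⇑(deriv (fun s : ℝ ↦ K.tubeδ δ (θ, w + EuclideanSpace.single 1 s)) 0)]) := by
  rw [← tubeFrameDet_eq_det_deriv (K.differentiable_tubeδ δ)]
  exact K.tubeFrameDet_tubeδ_pos hδ hδr (θ, w)

end SphereEmbedding


/-! ## Part III. Manifold packaging and the discharge -/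

attribute [local instance] fact_finrank_euclideanSpace_two fact_finrank_euclideanSpace_four

/-! ### Lifting a periodic map `ℝ × ℝ² → 𝕊³` to `𝕊¹ × ℝ²` -/

section PeriodicLift

variable {G : ℝ × 𝔼 2 → 𝔼 4}

/-- A map `2π`-periodic in its real argument takes equal values at reals with the same point on
the circle. [folklore] -/
theorem apply_eq_of_circlePoint_eq (hper : ∀ θ w, G (θ + 2 * Real.pi, w) = G (θ, w)) {s t : ℝ}
    (h : circlePoint s = circlePoint t) (w : 𝔼 2) : G (s, w) = G (t, w) :=
  Periodic.eq_of_circlePoint_eq (g := fun t ↦ G (t, w)) (fun t ↦ hper t w) h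

/-- The angle `2π · angA u` is a lift of `u ∈ 𝕊¹`. [folklore] -/
theorem circlePoint_two_pi_mul_angA (u : 𝕊 1) : circlePoint (2 * Real.pi * angA u) = u :=
  circlePt_angA u

/-- The angle `2π · angB u` is a lift of `u ∈ 𝕊¹`. [folklore] -/
theorem circlePoint_two_pi_mul_angB (u : 𝕊 1) : circlePoint (2 * Real.pi * angB u) = u :=
  circlePt_angB u

variable (G) in
/-- **The tube map on the manifold** `𝕊¹ × ℝ² → 𝕊³` induced by a map `G : ℝ × ℝ² → 𝕊³ ⊆ ℝ⁴`
which is `2π`-periodic in the first variable: `(u, w) ↦ G (θ, w)` for any angle `θ` of `u`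
(implemented with the angle function `angA` of `Literature.Topology.FourManifolds.TorusCoordinates`;
independent of the choice by periodicity, `coe_periodicLift_circlePoint`). [folklore] -/
def periodicLift (h1 : ∀ q, ‖G q‖ = 1) (p : (𝕊 1) × 𝔼 2) : 𝕊 3 :=
  ⟨G (2 * Real.pi * angA p.1, p.2), by rw [mem_sphere_zero_iff_norm, h1]⟩

/-- The tube map in `ℝ⁴`. [folklore] -/
theorem coe_periodicLift (h1 : ∀ q, ‖G q‖ = 1) (p : (𝕊 1) × 𝔼 2) :
    (periodicLift G h1 p : 𝔼 4) = G (2 * Real.pi * angA p.1, p.2) := rfl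

/-- **The tube map over an angle**: `periodicLift G (circlePoint t, w) = G (t, w)`. [folklore] -/
theorem coe_periodicLift_circlePoint (hper : ∀ θ w, G (θ + 2 * Real.pi, w) = G (θ, w))
    (h1 : ∀ q, ‖G q‖ = 1) (t : ℝ) (w : 𝔼 2) :
    (periodicLift G h1 (circlePoint t, w) : 𝔼 4) = G (t, w) := by
  rw [coe_periodicLift]
  exact apply_eq_of_circlePoint_eq hper (circlePoint_two_pi_mul_angA _) w

/-- The tube map computed with the other angle function `angB`. [folklore] -/
theorem coe_periodicLift_eq_angB (hper : ∀ θ w, G (θ + 2 * Real.pi, w) = G (θ, w))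
    (h1 : ∀ q, ‖G q‖ = 1) (p : (𝕊 1) × 𝔼 2) :
    (periodicLift G h1 p : 𝔼 4) = G (2 * Real.pi * angB p.1, p.2) := by
  rw [coe_periodicLift]
  exact apply_eq_of_circlePoint_eq hper
    (by rw [circlePoint_two_pi_mul_angA, circlePoint_two_pi_mul_angB]) p.2

/-- The angle chart `(u, w) ↦ (2π ang u, w)` is smooth where `ang` is. [folklore] -/
theorem contMDiffAt_angleProd {ang : (𝕊 1) → ℝ} {p : (𝕊 1) × 𝔼 2}
    (hang : ContMDiffAt (𝓡 1) 𝓘(ℝ, ℝ) ∞ ang p.1) :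
    ContMDiffAt 𝓘₁₂ 𝓘(ℝ, ℝ × 𝔼 2) ∞ (fun q : (𝕊 1) × 𝔼 2 ↦ (2 * Real.pi * ang q.1, q.2)) p := by
  have h1 : ContMDiffAt 𝓘₁₂ 𝓘(ℝ, ℝ) ∞ (fun q : (𝕊 1) × 𝔼 2 ↦ ang q.1) p :=
    hang.comp p contMDiffAt_fst
  have h2 : ContMDiffAt 𝓘₁₂ 𝓘(ℝ, ℝ) ∞ (fun q : (𝕊 1) × 𝔼 2 ↦ 2 * Real.pi * ang q.1) p :=
    (contDiff_const.mul contDiff_id).contDiffAt.comp_contMDiffAt h1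
  exact h2.prodMk_space contMDiffAt_snd

/-- The tube map followed by `𝕊³ ⊆ ℝ⁴` is smooth. [folklore] -/
theorem contMDiff_coe_periodicLift (hG : ContDiff ℝ ∞ G) (hper : ∀ θ w, G (θ + 2 * Real.pi, w) = G (θ, w))
    (h1 : ∀ q, ‖G q‖ = 1) :
    ContMDiff 𝓘₁₂ 𝓘(ℝ, 𝔼 4) ∞ fun p : (𝕊 1) × 𝔼 2 ↦ (periodicLift G h1 p : 𝔼 4) := by
  intro p
  by_cases hp : p.1 = ptA
  · have hfun : (fun p : (𝕊 1) × 𝔼 2 ↦ (periodicLift G h1 p : 𝔼 4)) =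
        G ∘ fun q : (𝕊 1) × 𝔼 2 ↦ (2 * Real.pi * angB q.1, q.2) :=
      funext fun q ↦ coe_periodicLift_eq_angB hper h1 q
    rw [hfun]
    have hB : p.1 ≠ ptB := by rw [hp]; exact ptA_ne_ptB
    exact hG.contDiffAt.comp_contMDiffAt (contMDiffAt_angleProd (contMDiffAt_angB hB))
  · have hfun : (fun p : (𝕊 1) × 𝔼 2 ↦ (periodicLift G h1 p : 𝔼 4)) =
        G ∘ fun q : (𝕊 1) × 𝔼 2 ↦ (2 * Real.pi * angA q.1, q.2) := rfl
    rw [hfun]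
    exact hG.contDiffAt.comp_contMDiffAt (contMDiffAt_angleProd (contMDiffAt_angA hp))

/-- **The tube map is smooth** as a map `𝕊¹ × ℝ² → 𝕊³`. [folklore] -/
theorem contMDiff_periodicLift (hG : ContDiff ℝ ∞ G) (hper : ∀ θ w, G (θ + 2 * Real.pi, w) = G (θ, w))
    (h1 : ∀ q, ‖G q‖ = 1) : ContMDiff 𝓘₁₂ (𝓡 3) ∞ (periodicLift G h1) :=
  (contMDiff_coe_periodicLift hG hper h1).codRestrict_sphere (n := 3) fun p ↦ (periodicLift G h1 p).2

/-- The tube map is continuous. [folklore] -/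
theorem continuous_periodicLift (hG : ContDiff ℝ ∞ G) (hper : ∀ θ w, G (θ + 2 * Real.pi, w) = G (θ, w))
    (h1 : ∀ q, ‖G q‖ = 1) : Continuous (periodicLift G h1) :=
  (contMDiff_periodicLift hG hper h1).continuous

/-- **Injectivity of the differential of the tube map.** At a point `p = (u, w)`, if the
differential of `G` at the lift `(2π ang u, w)` is injective for an angle function `ang` smooth
at `u`, then `mfderiv (periodicLift G) p` is injective: in `ℝ⁴`, `periodicLift G = G ∘ (2π ang × id)`
and `(circlePoint × id) ∘ (2π ang × id) = id`, so by the chain rule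
`d(𝕊³ ⊆ ℝ⁴) ∘ d(periodicLift G) = dG ∘ d(2π ang × id)` with both factors on the right injective.
[folklore] -/
theorem mfderiv_periodicLift_injective_of_angle (hG : ContDiff ℝ ∞ G)
    (hper : ∀ θ w, G (θ + 2 * Real.pi, w) = G (θ, w)) (h1 : ∀ q, ‖G q‖ = 1)
    {p : (𝕊 1) × 𝔼 2} {ang : (𝕊 1) → ℝ} (hang : ContMDiffAt (𝓡 1) 𝓘(ℝ, ℝ) ∞ ang p.1)
    (hsec : ∀ u, circlePoint (2 * Real.pi * ang u) = u)
    (hinj : Injective (fderiv ℝ G (2 * Real.pi * ang p.1, p.2))) :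
    Injective (mfderiv 𝓘₁₂ (𝓡 3) (periodicLift G h1) p) := by
  have hn : (∞ : WithTop ℕ∞) ≠ 0 := by simp
  set A : (𝕊 1) × 𝔼 2 → ℝ × 𝔼 2 := fun q ↦ (2 * Real.pi * ang q.1, q.2) with hAdef
  set P : ℝ × 𝔼 2 → (𝕊 1) × 𝔼 2 := fun q ↦ (circlePoint q.1, q.2) with hPdef
  have hA : ContMDiffAt 𝓘₁₂ 𝓘(ℝ, ℝ × 𝔼 2) ∞ A p := contMDiffAt_angleProd hang
  have hP : ContMDiff 𝓘(ℝ, ℝ × 𝔼 2) 𝓘₁₂ ∞ P :=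
    (contMDiff_circlePoint.comp contDiff_fst.contMDiff).prodMk contDiff_snd.contMDiff
  have hPA : P ∘ A = id := funext fun q ↦ Prod.ext (hsec q.1) rfl
  have hAd := hA.mdifferentiableAt hn
  have hPd := (hP (A p)).mdifferentiableAt hn
  -- `dP ∘ dA = id`, so `dA` is injective
  have hc : HasMFDerivAt 𝓘₁₂ 𝓘₁₂ (P ∘ A) p
      ((mfderiv 𝓘(ℝ, ℝ × 𝔼 2) 𝓘₁₂ P (A p)).comp (mfderiv 𝓘₁₂ 𝓘(ℝ, ℝ × 𝔼 2) A p)) :=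
    hPd.hasMFDerivAt.comp p hAd.hasMFDerivAt
  have hid : HasMFDerivAt 𝓘₁₂ 𝓘₁₂ (P ∘ A) p (ContinuousLinearMap.id ℝ (TangentSpace 𝓘₁₂ p)) := by
    rw [hPA]; exact hasMFDerivAt_id p
  have key1 := hasMFDerivAt_unique hc hid
  have hAinj : Injective (mfderiv 𝓘₁₂ 𝓘(ℝ, ℝ × 𝔼 2) A p) := by
    refine LeftInverse.injective (g := mfderiv 𝓘(ℝ, ℝ × 𝔼 2) 𝓘₁₂ P (A p)) fun v ↦ ?_
    exact DFunLike.congr_fun key1 v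
  -- `val ∘ periodicLift G = G ∘ A`
  have hfun : (G ∘ A) = (Subtype.val ∘ periodicLift G h1) := by
    funext q
    show G (2 * Real.pi * ang q.1, q.2) = G (2 * Real.pi * angA q.1, q.2)
    exact apply_eq_of_circlePoint_eq hper (by rw [hsec, circlePoint_two_pi_mul_angA]) q.2
  have hΦd : MDifferentiableAt 𝓘₁₂ (𝓡 3) (periodicLift G h1) p :=
    (contMDiff_periodicLift hG hper h1 p).mdifferentiableAt hn
  have hvald : MDifferentiableAt (𝓡 3) 𝓘(ℝ, 𝔼 4) (Subtype.val : (𝕊 3) → 𝔼 4) (periodicLift G h1 p) :=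
    (contMDiff_coe_sphere (periodicLift G h1 p)).mdifferentiableAt hn
  have hGd : MDifferentiableAt 𝓘(ℝ, ℝ × 𝔼 2) 𝓘(ℝ, 𝔼 4) G (A p) :=
    ((hG.differentiable (by simp)) (A p)).mdifferentiableAt
  have hc1 : HasMFDerivAt 𝓘₁₂ 𝓘(ℝ, 𝔼 4) (Subtype.val ∘ periodicLift G h1) p
      ((mfderiv (𝓡 3) 𝓘(ℝ, 𝔼 4) (Subtype.val : (𝕊 3) → 𝔼 4) (periodicLift G h1 p)).comp
        (mfderiv 𝓘₁₂ (𝓡 3) (periodicLift G h1) p)) :=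
    hvald.hasMFDerivAt.comp p hΦd.hasMFDerivAt
  have hc2 : HasMFDerivAt 𝓘₁₂ 𝓘(ℝ, 𝔼 4) (G ∘ A) p
      ((mfderiv 𝓘(ℝ, ℝ × 𝔼 2) 𝓘(ℝ, 𝔼 4) G (A p)).comp (mfderiv 𝓘₁₂ 𝓘(ℝ, ℝ × 𝔼 2) A p)) :=
    hGd.hasMFDerivAt.comp p hAd.hasMFDerivAt
  have hc2' : HasMFDerivAt 𝓘₁₂ 𝓘(ℝ, 𝔼 4) (Subtype.val ∘ periodicLift G h1) p
      ((mfderiv 𝓘(ℝ, ℝ × 𝔼 2) 𝓘(ℝ, 𝔼 4) G (A p)).comp (mfderiv 𝓘₁₂ 𝓘(ℝ, ℝ × 𝔼 2) A p)) :=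
    hc2.congr_of_eventuallyEq (Filter.EventuallyEq.of_eq hfun.symm)
  have key2 := hasMFDerivAt_unique hc1 hc2'
  have hGinj : Injective (mfderiv 𝓘(ℝ, ℝ × 𝔼 2) 𝓘(ℝ, 𝔼 4) G (A p)) := by
    rw [mfderiv_eq_fderiv]; exact hinj
  have hcomp : Injective fun v ↦ (mfderiv (𝓡 3) 𝓘(ℝ, 𝔼 4) (Subtype.val : (𝕊 3) → 𝔼 4)
      (periodicLift G h1 p)) ((mfderiv 𝓘₁₂ (𝓡 3) (periodicLift G h1) p) v) := by
    have hfun' : (fun v ↦ (mfderiv (𝓡 3) 𝓘(ℝ, 𝔼 4) (Subtype.val : (𝕊 3) → 𝔼 4)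
        (periodicLift G h1 p)) ((mfderiv 𝓘₁₂ (𝓡 3) (periodicLift G h1) p) v)) =
        fun v ↦ (mfderiv 𝓘(ℝ, ℝ × 𝔼 2) 𝓘(ℝ, 𝔼 4) G (A p)) ((mfderiv 𝓘₁₂ 𝓘(ℝ, ℝ × 𝔼 2) A p) v) :=
      funext fun v ↦ DFunLike.congr_fun key2 v
    rw [hfun']
    exact hGinj.comp hAinj
  exact Injective.of_comp hcomp

/-- **Injectivity of the differential of the tube map** at `p = (u, w)` from injectivity of
`fderiv G` at every lift `(t, w)` of `p`. [folklore] -/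
theorem mfderiv_periodicLift_injective (hG : ContDiff ℝ ∞ G)
    (hper : ∀ θ w, G (θ + 2 * Real.pi, w) = G (θ, w)) (h1 : ∀ q, ‖G q‖ = 1)
    {p : (𝕊 1) × 𝔼 2} (hinj : ∀ t : ℝ, circlePoint t = p.1 → Injective (fderiv ℝ G (t, p.2))) :
    Injective (mfderiv 𝓘₁₂ (𝓡 3) (periodicLift G h1) p) := by
  by_cases hp : p.1 = ptA
  · have hB : p.1 ≠ ptB := by rw [hp]; exact ptA_ne_ptB
    exact mfderiv_periodicLift_injective_of_angle hG hper h1 (contMDiffAt_angB hB)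
      circlePoint_two_pi_mul_angB (hinj _ (circlePoint_two_pi_mul_angB _))
  · exact mfderiv_periodicLift_injective_of_angle hG hper h1 (contMDiffAt_angA hp)
      circlePoint_two_pi_mul_angA (hinj _ (circlePoint_two_pi_mul_angA _))

/-- `dim (𝕊¹ × ℝ²) = dim 𝕊³` on the level of model vector spaces. [folklore] -/
theorem finrank_model_prod_eq :
    finrank ℝ (EuclideanSpace ℝ (Fin 1) × 𝔼 2) = finrank ℝ (𝔼 3) := by
  simp

/-- **The tube map is a local diffeomorphism** wherever its differential is injective
(`dim = 3` on both sides and the inverse function theorem on manifolds,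
`Literature.Topology.FourManifolds.isLocalDiffeomorphAt_of_mfderiv`). Hirsch (1976), §4.5, proof of Thm. 5.1. [folklore] -/
theorem isLocalDiffeomorphAt_periodicLift (hG : ContDiff ℝ ∞ G)
    (hper : ∀ θ w, G (θ + 2 * Real.pi, w) = G (θ, w)) (h1 : ∀ q, ‖G q‖ = 1)
    {p : (𝕊 1) × 𝔼 2} (hinj : ∀ t : ℝ, circlePoint t = p.1 → Injective (fderiv ℝ G (t, p.2))) :
    IsLocalDiffeomorphAt 𝓘₁₂ (𝓡 3) ∞ (periodicLift G h1) p := by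
  set L₀ : (EuclideanSpace ℝ (Fin 1) × 𝔼 2) →L[ℝ] 𝔼 3 := mfderiv 𝓘₁₂ (𝓡 3) (periodicLift G h1) p
    with hL₀
  have hinj' : Injective L₀ := mfderiv_periodicLift_injective hG hper h1 hinj
  have hsurj : Surjective L₀ :=
    (LinearMap.injective_iff_surjective_of_finrank_eq_finrank (f := (L₀ : _ →ₗ[ℝ] 𝔼 3))
      finrank_model_prod_eq).1 hinj'
  set L : (EuclideanSpace ℝ (Fin 1) × 𝔼 2) ≃L[ℝ] 𝔼 3 :=
    (LinearEquiv.ofBijective (L₀ : _ →ₗ[ℝ] 𝔼 3) ⟨hinj', hsurj⟩).toContinuousLinearEquiv with hL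
  refine isLocalDiffeomorphAt_of_mfderiv isOpen_univ (mem_univ p)
    (contMDiff_periodicLift hG hper h1).contMDiffOn (by norm_num) L ?_
  ext v
  rfl

/-- **The tube map is an immersion** (Mathlib's chart definition, complement `Unit`) wherever its
differential is injective: a local diffeomorphism is an immersion
(`Literature.Topology.FourManifolds.isImmersionAtOfComplement_of_eventuallyEq_openPartialHomeomorph`). [folklore] -/
theorem isImmersionAtOfComplement_periodicLift (hG : ContDiff ℝ ∞ G)
    (hper : ∀ θ w, G (θ + 2 * Real.pi, w) = G (θ, w)) (h1 : ∀ q, ‖G q‖ = 1)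
    {p : (𝕊 1) × 𝔼 2} (hinj : ∀ t : ℝ, circlePoint t = p.1 → Injective (fderiv ℝ G (t, p.2))) :
    Manifold.IsImmersionAtOfComplement Unit 𝓘₁₂ (𝓡 3) ∞ (periodicLift G h1) p := by
  obtain ⟨e, hpe, heq⟩ := isLocalDiffeomorphAt_periodicLift hG hper h1 hinj
  refine isImmersionAtOfComplement_of_eventuallyEq_openPartialHomeomorph e.toOpenPartialHomeomorph
    e.contMDiffOn_toFun e.contMDiffOn_invFun (ContinuousLinearEquiv.ofFinrankEq finrank_model_prod_eq)
    hpe ?_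
  exact Filter.eventuallyEq_of_mem (e.open_source.mem_nhds hpe) heq

/-- A local diffeomorphism is injective on a neighbourhood of the point. [folklore] -/
theorem exists_isOpen_injOn_of_isLocalDiffeomorphAt {f : (𝕊 1) × 𝔼 2 → 𝕊 3} {p : (𝕊 1) × 𝔼 2}
    (h : IsLocalDiffeomorphAt 𝓘₁₂ (𝓡 3) ∞ f p) :
    ∃ U : Set ((𝕊 1) × 𝔼 2), IsOpen U ∧ p ∈ U ∧ InjOn f U := by
  obtain ⟨e, hpe, heq⟩ := h
  exact ⟨e.source, e.open_source, hpe, fun x hx y hy hxy ↦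
    e.toPartialEquiv.injOn hx hy (by rw [← heq hx, ← heq hy]; exact hxy)⟩

end PeriodicLift

/-! ### The tubular neighbourhood of a knot -/

namespace SphereEmbedding

variable (K : SphereEmbedding 1 3)

/-- The **pre-tubular map** `ν̂ : 𝕊¹ × ℝ² → 𝕊³` of a knot: the tube map `tube K` lifted to the
manifold. It is the knot on the zero section and a local diffeomorphism along it, but not yet
injective (the fibres `ℝ²` are not yet squeezed). [folklore] -/
def preTubularMap : (𝕊 1) × 𝔼 2 → 𝕊 3 := periodicLift K.tube K.norm_tube

/-- The pre-tubular map over an angle. [folklore] -/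
theorem coe_preTubularMap_circlePoint (t : ℝ) (w : 𝔼 2) :
    (K.preTubularMap (circlePoint t, w) : 𝔼 4) = K.tube (t, w) :=
  coe_periodicLift_circlePoint K.tube_add_two_pi K.norm_tube t w

/-- On the zero section the pre-tubular map is the knot. [folklore] -/
@[simp] theorem preTubularMap_zero (u : 𝕊 1) : K.preTubularMap (u, 0) = K u := by
  obtain ⟨t, rfl⟩ := circlePoint_surjective u
  apply Subtype.ext
  rw [coe_preTubularMap_circlePoint, tube_zero, curve_apply]

/-- The pre-tubular map is continuous. [folklore] -/
theorem continuous_preTubularMap : Continuous K.preTubularMap :=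
  continuous_periodicLift K.contDiff_tube K.tube_add_two_pi K.norm_tube

/-- The pre-tubular map is a local diffeomorphism at the points of the zero section
(its Jacobian frame determinant is `det (γ, γ', N₁, N₂) > 0` there). [folklore] -/
theorem isLocalDiffeomorphAt_preTubularMap_zero (u : 𝕊 1) :
    IsLocalDiffeomorphAt 𝓘₁₂ (𝓡 3) ∞ K.preTubularMap (u, 0) :=
  isLocalDiffeomorphAt_periodicLift K.contDiff_tube K.tube_add_two_pi K.norm_tube
    fun t _ ↦ K.fderiv_tube_zero_injective t

/-- **An injectivity radius** (Hirsch (1976), §4.5, proof of Thm. 5.1 via Ex. 7 of §2.1: a local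
diffeomorphism which is injective on the compact zero section is injective on a neighbourhood of
it). There is `r > 0` such that the pre-tubular map is injective on `𝕊¹ × B (0, r)`: otherwise
pairs `p ≠ q` with `ν̂ p = ν̂ q` accumulate (compactness of `𝕊¹ × B̄ (0, 1)`) at a pair of points
of the zero section with the same image, i.e. at a diagonal point `((u, 0), (u, 0))` (`K` is
injective), near which `ν̂` is injective — a contradiction. [cite: Hirsch1976, §4.5 Thm 5.1] -/
theorem exists_injOn_preTubularMap :
    ∃ r : ℝ, 0 < r ∧ InjOn K.preTubularMap (univ ×ˢ Metric.ball (0 : 𝔼 2) r) := by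
  set f := K.preTubularMap with hfdef
  have hfc : Continuous f := K.continuous_preTubularMap
  -- neighbourhoods of injectivity along the zero section
  have hloc : ∀ u : 𝕊 1, ∃ U : Set ((𝕊 1) × 𝔼 2), IsOpen U ∧ (u, (0 : 𝔼 2)) ∈ U ∧ InjOn f U :=
    fun u ↦ exists_isOpen_injOn_of_isLocalDiffeomorphAt (K.isLocalDiffeomorphAt_preTubularMap_zero u)
  choose U hUo hUmem hUinj using hloc
  set W : Set (((𝕊 1) × 𝔼 2) × ((𝕊 1) × 𝔼 2)) := ⋃ u, U u ×ˢ U u with hWdef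
  have hW : IsOpen W := isOpen_iUnion fun u ↦ (hUo u).prod (hUo u)
  -- the compact set of bad pairs
  set C : Set ((𝕊 1) × 𝔼 2) := univ ×ˢ Metric.closedBall (0 : 𝔼 2) 1 with hCdef
  have hC : IsCompact C := isCompact_univ.prod (isCompact_closedBall 0 1)
  set Z : Set (((𝕊 1) × 𝔼 2) × ((𝕊 1) × 𝔼 2)) := {pq | f pq.1 = f pq.2} ∩ C ×ˢ C with hZdef
  have hZ : IsCompact Z :=
    (hC.prod hC).inter_left (isClosed_eq (hfc.comp continuous_fst) (hfc.comp continuous_snd))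
  have hZ₀ : IsCompact (Z \ W) := hZ.diff hW
  set g : ((𝕊 1) × 𝔼 2) × ((𝕊 1) × 𝔼 2) → ℝ := fun pq ↦ ‖pq.1.2‖ + ‖pq.2.2‖ with hgdef
  have hg : Continuous g := by fun_prop
  -- `g > 0` on the bad pairs outside `W`
  have hgpos : ∀ pq ∈ Z \ W, 0 < g pq := by
    rintro ⟨⟨u, w⟩, ⟨u', w'⟩⟩ ⟨⟨hpq, -⟩, hnotW⟩
    refine lt_of_le_of_ne (by positivity) fun h0 ↦ hnotW ?_
    simp only [hgdef] at h0
    have hw : w = 0 := norm_eq_zero.1 (by linarith [norm_nonneg w, norm_nonneg w'])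
    have hw' : w' = 0 := norm_eq_zero.1 (by linarith [norm_nonneg w, norm_nonneg w'])
    subst hw hw'
    have hK : K u = K u' := by
      rw [← preTubularMap_zero, ← preTubularMap_zero]
      exact hpq
    obtain rfl : u = u' := K.injective hK
    exact mem_iUnion.2 ⟨u, hUmem u, hUmem u⟩
  -- a positive lower bound `δ₀` of `g` on the bad pairs outside `W`
  obtain ⟨δ₀, hδ₀, hδ₀le⟩ : ∃ δ₀ : ℝ, 0 < δ₀ ∧ ∀ pq ∈ Z \ W, δ₀ ≤ g pq := by
    rcases (Z \ W).eq_empty_or_nonempty with h | h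
    · exact ⟨1, one_pos, fun pq hpq ↦ by rw [h] at hpq; exact absurd hpq (notMem_empty _)⟩
    · obtain ⟨pq₀, hpq₀, hmin⟩ := hZ₀.exists_isMinOn h hg.continuousOn
      exact ⟨g pq₀, hgpos pq₀ hpq₀, fun pq hpq ↦ hmin hpq⟩
  refine ⟨min (δ₀ / 2) 1, by positivity, ?_⟩
  rintro p ⟨-, hp⟩ q ⟨-, hq⟩ hpq
  rw [Metric.mem_ball, dist_zero_right, lt_min_iff] at hp hq
  by_contra hne
  have hpC : p ∈ C := ⟨mem_univ _, Metric.mem_closedBall.2 (by rw [dist_zero_right]; exact hp.2.le)⟩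
  have hqC : q ∈ C := ⟨mem_univ _, Metric.mem_closedBall.2 (by rw [dist_zero_right]; exact hq.2.le)⟩
  have hmem : (p, q) ∈ Z \ W := by
    refine ⟨⟨hpq, hpC, hqC⟩, fun hWmem ↦ hne ?_⟩
    obtain ⟨u, hu⟩ := mem_iUnion.1 hWmem
    exact hUinj u hu.1 hu.2 hpq
  have := hδ₀le _ hmem
  simp only [hgdef] at this
  linarith [hp.1, hq.1]

/-- An injectivity radius of the pre-tubular map (`exists_injOn_preTubularMap`). [folklore] -/
def injRadius : ℝ := Classical.choose K.exists_injOn_preTubularMap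

/-- The injectivity radius is positive. [folklore] -/
theorem injRadius_pos : 0 < K.injRadius := (Classical.choose_spec K.exists_injOn_preTubularMap).1

/-- The pre-tubular map is injective on `𝕊¹ × B (0, injRadius)`. [folklore] -/
theorem injOn_preTubularMap : InjOn K.preTubularMap (univ ×ˢ Metric.ball (0 : 𝔼 2) K.injRadius) :=
  (Classical.choose_spec K.exists_injOn_preTubularMap).2

/-- **The radius of the tubular neighbourhood**: the smaller of the radius of positive Jacobian
and the injectivity radius. [folklore] -/
def tubularRadius : ℝ := min K.jacobiRadius K.injRadius

/-- The tubular radius is positive. [folklore] -/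
theorem tubularRadius_pos : 0 < K.tubularRadius := lt_min K.jacobiRadius_pos K.injRadius_pos

/-- The tubular radius is at most the radius of positive Jacobian. [folklore] -/
theorem tubularRadius_le_jacobiRadius : K.tubularRadius ≤ K.jacobiRadius := min_le_left _ _

/-- The tubular radius is at most the injectivity radius. [folklore] -/
theorem tubularRadius_le_injRadius : K.tubularRadius ≤ K.injRadius := min_le_right _ _

/-- **The tubular map** `ν : 𝕊¹ × ℝ² → 𝕊³` of a knot: the squeezed tube `tubeδ K δ`,
`δ = tubularRadius K`, lifted to the manifold — i.e. `ν (u, w) = ν̂ (u, σ_δ w)`. [folklore] -/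
def tubularMap : (𝕊 1) × 𝔼 2 → 𝕊 3 :=
  periodicLift (K.tubeδ K.tubularRadius) (K.norm_tubeδ K.tubularRadius)

/-- The tubular map is the pre-tubular map after squeezing the fibre. [folklore] -/
theorem tubularMap_apply (p : (𝕊 1) × 𝔼 2) :
    K.tubularMap p = K.preTubularMap (p.1, squeeze K.tubularRadius p.2) :=
  Subtype.ext rfl

/-- The tubular map over an angle. [folklore] -/
theorem coe_tubularMap_circlePoint (t : ℝ) (w : 𝔼 2) :
    (K.tubularMap (circlePoint t, w) : 𝔼 4) = K.tubeδ K.tubularRadius (t, w) :=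
  coe_periodicLift_circlePoint (K.tubeδ_add_two_pi K.tubularRadius) (K.norm_tubeδ K.tubularRadius) t w

/-- **The tubular map extends the knot**: `ν (u, 0) = K u`. [folklore] -/
@[simp] theorem tubularMap_zero (u : 𝕊 1) : K.tubularMap (u, 0) = K u := by
  rw [tubularMap_apply, squeeze_zero, preTubularMap_zero]

/-- The tubular map is smooth. [folklore] -/
theorem contMDiff_tubularMap : ContMDiff 𝓘₁₂ (𝓡 3) ∞ K.tubularMap :=
  contMDiff_periodicLift (K.contDiff_tubeδ _) (K.tubeδ_add_two_pi _) (K.norm_tubeδ _)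

/-- **The tubular map is injective**: `ν (u, w) = ν̂ (u, σ w)` with `σ` injective into the disc
of radius `tubularRadius ≤ injRadius`, on which `ν̂` is injective. [folklore] -/
theorem tubularMap_injective : Injective K.tubularMap := by
  intro p q h
  have hball : ∀ w : 𝔼 2, squeeze K.tubularRadius w ∈ Metric.ball (0 : 𝔼 2) K.injRadius :=
    fun w ↦ by
    rw [Metric.mem_ball, dist_zero_right]
    exact (norm_squeeze_lt K.tubularRadius_pos w).trans_le K.tubularRadius_le_injRadius
  have hp : (p.1, squeeze K.tubularRadius p.2) ∈ univ ×ˢ Metric.ball (0 : 𝔼 2) K.injRadius :=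
    Set.mk_mem_prod (mem_univ _) (hball p.2)
  have hq : (q.1, squeeze K.tubularRadius q.2) ∈ univ ×ˢ Metric.ball (0 : 𝔼 2) K.injRadius :=
    Set.mk_mem_prod (mem_univ _) (hball q.2)
  have h2 : K.preTubularMap (p.1, squeeze K.tubularRadius p.2) =
      K.preTubularMap (q.1, squeeze K.tubularRadius q.2) := by
    rw [← tubularMap_apply, ← tubularMap_apply]
    exact h
  have h' : (p.1, squeeze K.tubularRadius p.2) = (q.1, squeeze K.tubularRadius q.2) :=
    K.injOn_preTubularMap hp hq h2
  obtain ⟨h1, h3⟩ := Prod.mk_inj.1 h'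
  exact Prod.ext h1 (squeeze_injective K.tubularRadius_pos h3)

/-- **The tubular map is a local diffeomorphism everywhere** (its Jacobian frame determinant is
positive everywhere since `tubularRadius ≤ jacobiRadius`). [folklore] -/
theorem isLocalDiffeomorph_tubularMap : IsLocalDiffeomorph 𝓘₁₂ (𝓡 3) ∞ K.tubularMap := fun p ↦
  isLocalDiffeomorphAt_periodicLift (K.contDiff_tubeδ _) (K.tubeδ_add_two_pi _) (K.norm_tubeδ _)
    fun t _ ↦ K.fderiv_tubeδ_injective K.tubularRadius_pos K.tubularRadius_le_jacobiRadius (t, p.2)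

/-- **The tubular map is an immersion** (Mathlib's `Manifold.IsImmersion`, via the global
complement `Unit`). [folklore] -/
theorem isImmersion_tubularMap : Manifold.IsImmersion 𝓘₁₂ (𝓡 3) ∞ K.tubularMap :=
  Manifold.IsImmersionOfComplement.isImmersion (F := Unit) fun p ↦
    isImmersionAtOfComplement_periodicLift (K.contDiff_tubeδ _) (K.tubeδ_add_two_pi _) (K.norm_tubeδ _)
      fun t _ ↦ K.fderiv_tubeδ_injective K.tubularRadius_pos K.tubularRadius_le_jacobiRadius (t, p.2)

/-- **The tubular map is an open embedding**: an injective local homeomorphism. [folklore] -/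
theorem isOpenEmbedding_tubularMap : Topology.IsOpenEmbedding K.tubularMap :=
  K.isLocalDiffeomorph_tubularMap.isLocalHomeomorph.isOpenEmbedding_of_injective K.tubularMap_injective

/-- **The tubular map is a smooth embedding.** [folklore] -/
theorem isSmoothEmbedding_tubularMap : Manifold.IsSmoothEmbedding 𝓘₁₂ (𝓡 3) ∞ K.tubularMap :=
  ⟨K.isImmersion_tubularMap, K.isOpenEmbedding_tubularMap.isEmbedding⟩

/-- **The tubular map is positively oriented** in the sense of `Literature.Topology.FourManifolds.Knot.TubularNbhd.det_pos`:
over the angle `θ` it is the squeezed tube `G_δ (θ, ·)`, whose frame determinant is positive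
(`det_deriv_tubeδ_pos`). [folklore] -/
theorem det_pos_tubularMap (θ : ℝ) (w : 𝔼 2) :
    0 < Matrix.det (Matrix.of
      ![⇑(K.tubularMap (circlePoint θ, w) : 𝔼 4),
        ⇑(deriv (fun t : ℝ ↦ (K.tubularMap (circlePoint t, w) : 𝔼 4)) θ),
        ⇑(deriv (fun s : ℝ ↦ (K.tubularMap (circlePoint θ, w + EuclideanSpace.single 0 s) : 𝔼 4)) 0),
        ⇑(deriv (fun s : ℝ ↦ (K.tubularMap (circlePoint θ, w + EuclideanSpace.single 1 s) : 𝔼 4)) 0)]) := by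
  simp only [coe_tubularMap_circlePoint]
  exact K.det_deriv_tubeδ_pos K.tubularRadius_pos K.tubularRadius_le_jacobiRadius θ w

/-- **The oriented tubular neighbourhood of a knot** (Hirsch (1976), §4.5 Thm. 5.2 for the
submanifold `K (𝕊¹) ⊆ 𝕊³`, with the framing chosen positively oriented). [cite: Hirsch1976, §4.5 Thm 5.2] -/
def tubularNbhd : Knot.TubularNbhd K where
  toFun := K.tubularMap
  isSmoothEmbedding := K.isSmoothEmbedding_tubularMap
  apply_zero := K.tubularMap_zero
  det_pos := K.det_pos_tubularMap

end SphereEmbedding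

/-- **Existence of oriented tubular neighbourhoods of knots** (discharge of the named fact
`Literature.Topology.FourManifolds.Knot.nonempty_tubularNbhd`): every smooth knot `K : 𝕊¹ → 𝕊³` has an oriented tubular
neighbourhood, namely `K.tubularNbhd` — Hirsch's tube `f (x, y) = (x + y) / ‖x + y‖` over a
positively oriented normal framing, squeezed to an injectivity radius.
Hirsch, *Differential Topology* (1976), §4.5, Thm. 5.1–5.2. [cite: Hirsch1976, §4.5 Thm 5.2] -/
theorem Knot.nonempty_tubularNbhd_holds : Knot.nonempty_tubularNbhd := fun K ↦
  ⟨SphereEmbedding.tubularNbhd K⟩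

end Literature.Topology.FourManifolds
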